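import Literature.NumberTheory.DiophantineGeometry.StewartYuPadicLogForms
import Literature.NumberTheory.DiophantineGeometry.MultiplicativeGroupApproximationProofs

/-!
# Stewart 2013, Lemma 5 over `ℚ`: one logarithm (`n ≤ 1`) and the Liouville range (`B ≤ 10⁸`), proved

Topic `NumberTheory/DiophantineGeometry`; namespace `Literature.NumberTheory.DiophantineGeometry.Dioph`.

`StewartYuPadicLogForms.lean` vendors Lemma 5 of C. L. Stewart, *On divisors of Lucas and Lehmer
numbers*, Acta Math. 211 (2013) 291–314 [Stewart2013] (arXiv:1008.1274, §3, p. 8 = Acta Lemma 3.1),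
case `K = ℚ`, as the named fact `Stewart2013_lemma5_rat` — since 2026-08-15 in the form
`max(log B, G₁^ℚ(n))` of Stewart's displays (3.2)–(3.3) with Yu's published `G₁(n,1)` (see the
*Restatement record* there), whereas the theorems of THIS file are stated for the PRINTED form
`max(log B, (n+1) · 5.4n)`; the printed form implies the fact's form for `n ≤ 6`
(`printed_le_yuG1Rat`) and the glue in both directions lives in
`StewartYuPadicLogFormsReduction.lean` (`Stewart2013_lemma5_rat_of_yuBound`,
`Stewart2013_lemma5_rat.printed_of`). For `n ≥ 2` logarithms the statement is K. Yu's Main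
Theorem on `p`-adic logarithmic forms (Acta Math. 211 (2013) 315–382) with Stewart's explicit
constant, i.e. `p`-adic Baker theory, and is NOT proved here.

This file proves the printed statement **for `n ≤ 1`** (`Stewart2013_lemma5_rat_of_le_one`; this
yields the fact for `n ≤ 1`), where it is elementary: for a rational `p`-adic unit `q = a/d ≠ ±1`,
`t ≠ 0`, `r` the order of `q̄` in `𝔽_pˣ`, and `X > Y` the two numbers `a², d²`,

  `ord_p(q^t − 1) = ord_p(q^{|t|} − 1) ≤ ord_p(q^{2|t|} − 1) = v_p(X^{|t|} − Y^{|t|})`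
  `≤ v_p(X^{r|t|} − Y^{r|t|}) = v_p(X^r − Y^r) + v_p(|t|)`   (lifting the exponent, `p ∣ X^r − Y^r`)
  `≤ (2 r h(q) + log B) / log p`,

while Stewart's constant satisfies `C ≥ 21056 · max(r / log p, e log p)` because `p/δ ≥ r`
(`δ = (p−1)/|⟨−1, q̄⟩|` and `|⟨−1, q̄⟩| ≥ r`, or `δ = 1`). The case `n = 0` is vacuous (`b ≠ 0` is
impossible). The explicit one-logarithm estimate `ord_p(qᵗ − 1) log p ≤ 2 r h(q) + log |t|`
(`r = ord(q̄) ≤ p − 1`) is recorded on its own (`padicValRat_zpow_sub_one_mul_log_le`). Design: all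
intermediate results are ordinary theorems of this file; nothing new is assumed. What is NOT here:
any case `n ≥ 2` with `B > 10⁸`.

## Also proved here: the Liouville range `B ≤ 10⁸` (all `n`), and the arithmetic of the printed step (19)

* `padicValRat_prod_zpow_sub_one_mul_log_le`: the trivial (Liouville) estimate over `ℚ`,
  `ord_p(α₁^{b₁}⋯αₙ^{bₙ} − 1) · log p ≤ log 2 + ∑ |bᵢ| h(αᵢ)` — linear in `B`, whereas Lemma 5 is
  logarithmic in `B`;
* `Stewart2013_lemma5_rat_of_stewartB_le`: the printed conclusion of Lemma 5 over `ℚ` for **every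
  `n`** as soon as `B ≤ 10⁸` (for `n ≥ 2` the trivial estimate is already below Stewart's bound,
  because `C ≥ 1504 (7e²)ⁿ log p` (`stewartC_ge`) and `h(αᵢ) ≥ log 2`);
* `stewart_G1_gt` / `stewart_G1_le`: with `G₁ = (n+1)((2 + log 7)n + 5.25 + log((2 + log 7)n
  + 5.25) + log d)` as printed in the proof of Lemma 5 (arXiv:1008.1274, p. 8), the printed step
  "`G₁ ≤ (n+1)(5.4n + log d)`" ((19)) is, for `d = 1`, FALSE for `1 ≤ n ≤ 5` and TRUE for `n ≥ 6`
  (machine-checked here from `1.9 < log 7 < 1.95`). So the printed derivation of Lemma 5 from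
  Yu's Main Theorem (which itself assumes `n ≥ 2`) establishes the printed constant
  `max(log B, (n+1)(5.4n + log d))` only for `n ≥ 6`; for `2 ≤ n ≤ 5` it gives `max(log B, G₁)`.
  (With Yu's published `d = 1` constant `5.84` in place of Stewart's `5.25` the threshold is
  `n = 7`: `yuG1Rat_le_printed` in the Reduction file.) Since 2026-08-15 the named fact is
  therefore stated in the `max(log B, G₁^ℚ(n))` form, not the printed one.
* `yu1989_lemma1_4_rat` (with `padicValRat_zpow_sub_one_mul_log_le_sharp`): **[Yu1989,
  Lemma 1.4] over `ℚ` for odd `p`**, as restated in [Yu2013, §2, p. 327] — the input of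
  [Yu2013, Lemma 2.1] (Theorem I in the case `r = 1` of the basic hypothesis):
  `ord_p(α^b − 1) ≤ (1/log p)(log(2|b|) + |⟨ᾱ⟩|(1 + 1/(p−1)) h(α))` for a rational `p`-adic unit
  `α`, `b ≠ 0`, `α^b ≠ 1`; proved in the sharper form `ord_p(α^b − 1) log p ≤ log 2 + |⟨ᾱ⟩| h(α)
  + log|b|` by the lifting-the-exponent lemma (`p = 2` not treated).

## References

* [Stewart2013] C. L. Stewart, *On divisors of Lucas and Lehmer numbers*, Acta Math. 211 (2013),
  291–314 (arXiv:1008.1274), §3, Lemma 5 (p. 8) and (16).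
* [Yu2013] K. Yu, *p-adic logarithmic forms and a problem of Erdős*, Acta Math. 211 (2013),
  315–382: §2, p. 327 (restatement of [35, Lemma 1.4]) and Lemma 2.1.
* [Yu1989] K. Yu, *Linear forms in p-adic logarithms*, Acta Arith. 53 (1989), 107–186: Lemma 1.4
  (held copy image-only; read in the restated form of [Yu2013]).
-/

open Height Real Finset

noncomputable section

namespace Literature.NumberTheory.DiophantineGeometry.Dioph

/-! ### `p`-adic valuations of `x - 1` in `ℚ` -/

/-- For a `p`-adic unit `x ∈ ℚ`, `ord_p(x⁻¹ − 1) = ord_p(x − 1)` (`x⁻¹ − 1 = −(x − 1)·x⁻¹`).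
[folklore] -/
theorem padicValRat_inv_sub_one {p : ℕ} [Fact p.Prime] {x : ℚ} (hx : x ≠ 0)
    (hv : padicValRat p x = 0) : padicValRat p (x⁻¹ - 1) = padicValRat p (x - 1) := by
  by_cases h1 : x = 1
  · subst h1; simp
  have hx1 : x - 1 ≠ 0 := sub_ne_zero.mpr h1
  have hrw : x⁻¹ - 1 = -(x - 1) * x⁻¹ := by field_simp; ring
  rw [hrw, padicValRat.mul (neg_ne_zero.mpr hx1) (inv_ne_zero hx), padicValRat.neg,
    padicValRat.inv, hv]
  simp

/-- For a `p`-adic unit `x ∈ ℚ` with `x ≠ −1`, `ord_p(x + 1) ≥ 0` (ultrametric inequality).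
[folklore] -/
theorem padicValRat_add_one_nonneg {p : ℕ} [Fact p.Prime] {x : ℚ} (hv : padicValRat p x = 0)
    (hx1 : x + 1 ≠ 0) : 0 ≤ padicValRat p (x + 1) := by
  have h := padicValRat.min_le_padicValRat_add (p := p) hx1
  rw [hv, padicValRat.one, min_self] at h
  exact h

/-- For a `p`-adic unit `x ∈ ℚ` with `x^{2n} ≠ 1`, `ord_p(xⁿ − 1) ≤ ord_p(x^{2n} − 1)`
(`x^{2n} − 1 = (xⁿ − 1)(xⁿ + 1)` and `ord_p(xⁿ + 1) ≥ 0`). [folklore] -/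
theorem padicValRat_pow_sub_one_le_sq {p : ℕ} [Fact p.Prime] {x : ℚ} (hv : padicValRat p x = 0)
    (n : ℕ) (hx : x ^ (2 * n) ≠ 1) :
    padicValRat p (x ^ n - 1) ≤ padicValRat p (x ^ (2 * n) - 1) := by
  have hfac : x ^ (2 * n) - 1 = (x ^ n - 1) * (x ^ n + 1) := by ring
  have h1 : x ^ n - 1 ≠ 0 := fun h => hx (by rw [← sub_eq_zero, hfac, h, zero_mul])
  have h2 : x ^ n + 1 ≠ 0 := fun h => hx (by rw [← sub_eq_zero, hfac, h, mul_zero])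
  rw [hfac, padicValRat.mul h1 h2]
  have h3 : 0 ≤ padicValRat p (x ^ n + 1) :=
    padicValRat_add_one_nonneg (by rw [padicValRat.pow, hv, mul_zero]) h2
  linarith

/-- For a `p`-adic unit `x ∈ ℚ` and `t ∈ ℤ`, `ord_p(xᵗ − 1) = ord_p(x^{|t|} − 1)`. [folklore] -/
theorem padicValRat_zpow_sub_one_eq_natAbs {p : ℕ} [Fact p.Prime] {x : ℚ} (hx : x ≠ 0)
    (hv : padicValRat p x = 0) (t : ℤ) :
    padicValRat p (x ^ t - 1) = padicValRat p (x ^ t.natAbs - 1) := by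
  obtain ⟨n, rfl | rfl⟩ := Int.eq_nat_or_neg t
  · rw [Int.natAbs_natCast, zpow_natCast]
  · rw [Int.natAbs_neg, Int.natAbs_natCast, zpow_neg, zpow_natCast]
    exact padicValRat_inv_sub_one (pow_ne_zero _ hx) (by rw [padicValRat.pow, hv, mul_zero])

/-- For naturals `Y < X` with `p ∤ Y`, `ord_p((X/Y)ⁿ − 1) = v_p(Xⁿ − Yⁿ)`. [folklore] -/
theorem padicValRat_div_pow_sub_one_eq {p : ℕ} [hp : Fact p.Prime] {X Y : ℕ} (hYX : Y < X)
    (hY : ¬ p ∣ Y) (n : ℕ) :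
    padicValRat p ((((X : ℕ) : ℚ) / Y) ^ n - 1) = padicValNat p (X ^ n - Y ^ n) := by
  rcases Nat.eq_zero_or_pos n with rfl | hn
  · simp
  have hY0 : Y ≠ 0 := fun h => hY (h ▸ dvd_zero p)
  have hY0' : ((Y : ℕ) : ℚ) ≠ 0 := by exact_mod_cast hY0
  have hle : Y ^ n ≤ X ^ n := Nat.pow_le_pow_left hYX.le n
  have hlt : Y ^ n < X ^ n := Nat.pow_lt_pow_left hYX hn.ne'
  have hrw : (((X : ℕ) : ℚ) / Y) ^ n - 1 = (((X ^ n - Y ^ n : ℕ) : ℚ)) / ((Y ^ n : ℕ) : ℚ) := by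
    rw [Nat.cast_sub hle, Nat.cast_pow, Nat.cast_pow, sub_div, div_self (pow_ne_zero _ hY0'),
      div_pow]
  have hnum : ((X ^ n - Y ^ n : ℕ) : ℚ) ≠ 0 := by exact_mod_cast (Nat.sub_pos_of_lt hlt).ne'
  have hden : ((Y ^ n : ℕ) : ℚ) ≠ 0 := by exact_mod_cast pow_ne_zero _ hY0
  rw [hrw, padicValRat.div hnum hden, padicValRat.of_nat, padicValRat.of_nat, padicValNat.pow,
    padicValNat.eq_zero_of_not_dvd hY]
  simp

/-- **Lifting the exponent with an arbitrary period.** For an odd prime `p`, naturals `Y < X` with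
`p ∤ X`, `r ≥ 1` with `p ∣ Xʳ − Yʳ`, and every `n`:
`v_p(Xⁿ − Yⁿ) ≤ v_p(Xʳ − Yʳ) + v_p(n)` (as `Xⁿ − Yⁿ ∣ X^{rn} − Y^{rn}` and, by the
lifting-the-exponent lemma, `v_p((Xʳ)ⁿ − (Yʳ)ⁿ) = v_p(Xʳ − Yʳ) + v_p(n)`). [folklore] -/
theorem padicValNat_pow_sub_pow_le_of_dvd {p X Y : ℕ} [hp : Fact p.Prime] (hp2 : p ≠ 2)
    (hYX : Y < X) (hX : ¬ p ∣ X) {r : ℕ} (hr : r ≠ 0) (hdiv : p ∣ X ^ r - Y ^ r) (n : ℕ) :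
    padicValNat p (X ^ n - Y ^ n) ≤ padicValNat p (X ^ r - Y ^ r) + padicValNat p n := by
  rcases Nat.eq_zero_or_pos n with rfl | hn
  · simp
  have hp1 : Odd p := hp.out.odd_of_ne_two hp2
  set x := X ^ r with hx_def
  set y := Y ^ r with hy_def
  have hyx : y < x := Nat.pow_lt_pow_left hYX hr
  have hx : ¬ p ∣ x := fun h => hX (hp.out.dvd_of_dvd_pow h)
  have key : padicValNat p (x ^ n - y ^ n) = padicValNat p (x - y) + padicValNat p n :=
    padicValNat.pow_sub_pow hp1 hyx hdiv hx hn.ne'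
  have hdvd : X ^ n - Y ^ n ∣ x ^ n - y ^ n := by
    have hx' : x ^ n = (X ^ n) ^ r := by rw [hx_def, ← pow_mul, ← pow_mul, mul_comm]
    have hy' : y ^ n = (Y ^ n) ^ r := by rw [hy_def, ← pow_mul, ← pow_mul, mul_comm]
    rw [hx', hy']
    exact Nat.sub_dvd_pow_sub_pow _ _ _
  have hne : x ^ n - y ^ n ≠ 0 := Nat.sub_ne_zero_of_lt (Nat.pow_lt_pow_left hyx hn.ne')
  have hle : padicValNat p (X ^ n - Y ^ n) ≤ padicValNat p (x ^ n - y ^ n) :=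
    (padicValNat_dvd_iff_le hne).mp (dvd_trans pow_padicValNat_dvd hdvd)
  omega

/-- `v_p(N) · log p ≤ log N` for `N ≥ 1` (`p^{v_p(N)} ≤ N`). [folklore] -/
theorem padicValNat_mul_log_le {p : ℕ} (hp : p.Prime) {N : ℕ} (hN : N ≠ 0) :
    (padicValNat p N : ℝ) * Real.log p ≤ Real.log N := by
  haveI := Fact.mk hp
  have h : p ^ padicValNat p N ≤ N := Nat.le_of_dvd (Nat.pos_of_ne_zero hN) pow_padicValNat_dvd
  have h' : ((p : ℝ) ^ padicValNat p N) ≤ N := by exact_mod_cast h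
  have hp0 : (0 : ℝ) < p := by exact_mod_cast hp.pos
  rw [← Real.log_pow]
  exact Real.log_le_log (pow_pos hp0 _) h'

/-! ### The order of `q̄` and the subgroup `⟨−1, ᾱ⟩` -/

/-- The order of the reduction `ᾱᵢ` of a `p`-adic unit in `ℤ/pℤ` is at most
`|⟨−1, ᾱ₁, …, ᾱₙ⟩|` (its powers lie in the generated submonoid; computed inside `(ℤ/pℤ)ˣ`).
[folklore] -/
theorem orderOf_ratModP_le_stewartSubgroupCard {p : ℕ} (hp : p.Prime) {n : ℕ} {α : Fin n → ℚ}
    (hα : ∀ i, α i ≠ 0 ∧ padicValRat p (α i) = 0) (i : Fin n) :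
    orderOf (ratModP p (α i)) ≤ stewartSubgroupCard p α := by
  haveI := Fact.mk hp
  unfold stewartSubgroupCard
  set S := Submonoid.closure (insert (-1 : ZMod p) (Set.range fun i : Fin n => ratModP p (α i)))
  have hmem : ratModP p (α i) ∈ S := Submonoid.subset_closure (Set.mem_insert_of_mem _ ⟨i, rfl⟩)
  obtain ⟨u, hu⟩ := isUnit_ratModP hp (hα i).1 (hα i).2
  set T : Submonoid (ZMod p)ˣ := S.comap (Units.coeHom (ZMod p)) with hT
  have huT : u ∈ T := by
    rw [hT, Submonoid.mem_comap, Units.coeHom_apply, hu]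
    exact hmem
  have h1 : orderOf u ≤ Nat.card T := Submonoid.orderOf_le_card T (Set.toFinite _) huT
  let f : T → S := fun x => ⟨((x.1 : (ZMod p)ˣ) : ZMod p), x.2⟩
  have hf : Function.Injective f := by
    intro x y hxy
    apply Subtype.ext
    apply Units.ext
    exact congrArg Subtype.val hxy
  have h2 : Nat.card T ≤ Nat.card S := Nat.card_le_card_of_injective f hf
  rw [← hu, orderOf_units]
  exact h1.trans h2

/-- The order of the reduction of a rational `p`-adic unit is positive (it is a unit of the
finite ring `ℤ/pℤ`). [folklore] -/
theorem orderOf_ratModP_pos {p : ℕ} (hp : p.Prime) {q : ℚ} (hq : q ≠ 0)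
    (hv : padicValRat p q = 0) : 0 < orderOf (ratModP p q) := by
  haveI := Fact.mk hp
  obtain ⟨u, hu⟩ := isUnit_ratModP hp hq hv
  rw [← hu, orderOf_units]
  exact orderOf_pos u

/-- If `r` is the order of `q̄ = ā·d̄⁻¹` in `ℤ/pℤ` (`q = a/d` in lowest terms, `p ∤ d`), then
`(a²)ʳ ≡ (d²)ʳ (mod p)`. [folklore] -/
theorem natAbs_num_sq_pow_orderOf_eq {p : ℕ} [hp : Fact p.Prime] {q : ℚ} (hpD : ¬ p ∣ q.den) :
    (((q.num.natAbs ^ 2) ^ orderOf (ratModP p q) : ℕ) : ZMod p) =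
      (((q.den ^ 2) ^ orderOf (ratModP p q) : ℕ) : ZMod p) := by
  set r := orderOf (ratModP p q) with hr_def
  have h1 : (ratModP p q) ^ r = 1 := pow_orderOf_eq_one _
  unfold ratModP at h1
  have hD : (q.den : ZMod p) ≠ 0 := fun h => hpD ((ZMod.natCast_eq_zero_iff _ _).mp h)
  rw [mul_pow, inv_pow, ← div_eq_mul_inv, div_eq_one_iff_eq (pow_ne_zero _ hD)] at h1
  have hA2 : ((q.num.natAbs : ℕ) : ZMod p) ^ 2 = (q.num : ZMod p) ^ 2 := by
    rw [Nat.cast_natAbs, ← Int.cast_pow, sq_abs, Int.cast_pow]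
  push_cast
  rw [hA2, ← pow_mul, ← pow_mul, mul_comm 2 r, pow_mul, pow_mul, h1]

/-- `r ≤ p/δ` for `r` the order of `ᾱᵢ`: in the Kummer case `p/δ = p·|⟨−1, ᾱ⟩|/(p − 1) ≥ |⟨−1, ᾱ⟩| ≥ r`,
otherwise `p/δ = p > p − 1 ≥ |⟨−1, ᾱ⟩| ≥ r`. [cite: Stewart2013, §3 (definition of δ)] -/
theorem orderOf_ratModP_le_div_stewartDelta {p : ℕ} (hp : p.Prime) {n : ℕ} {α : Fin n → ℚ}
    (hα : ∀ i, α i ≠ 0 ∧ padicValRat p (α i) = 0) (i : Fin n) :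
    (orderOf (ratModP p (α i)) : ℝ) ≤ (p : ℝ) / stewartDelta p α := by
  haveI := Fact.mk hp
  have hN := orderOf_ratModP_le_stewartSubgroupCard hp hα i
  have hNp := stewartSubgroupCard_le hp hα
  have hrN : (orderOf (ratModP p (α i)) : ℝ) ≤ stewartSubgroupCard p α := by exact_mod_cast hN
  have hNp' : (stewartSubgroupCard p α : ℝ) ≤ (p : ℝ) - 1 := by
    have : ((p - 1 : ℕ) : ℝ) = (p : ℝ) - 1 := by rw [Nat.cast_sub hp.one_lt.le, Nat.cast_one]
    rw [← this]
    exact_mod_cast hNp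
  unfold stewartDelta
  split_ifs with hK
  · have hN0 : (0 : ℝ) < stewartSubgroupCard p α := by
      exact_mod_cast one_le_stewartSubgroupCard p α
    have hp1' : (0 : ℝ) < (p : ℝ) - 1 := by
      have h2 : (2 : ℝ) ≤ p := by exact_mod_cast hp.two_le
      linarith
    rw [div_div_eq_mul_div, le_div_iff₀ hp1']
    nlinarith [hrN, hNp', hN0]
  · rw [div_one]
    linarith

/-! ### The reduction to integers and the lifting-the-exponent bound -/

/-- **The elementary chain.** For an odd prime `p`, a rational `p`-adic unit `q = a/d` with
`q² ≠ 1` and `q^{2|t|} ≠ 1`, `X = max(a², d²) > Y = min(a², d²)` and `r` the order of `q̄` in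
`ℤ/pℤ`: `ord_p(qᵗ − 1) ≤ v_p(Xʳ − Yʳ) + v_p(|t|)`
(`ord_p(qᵗ − 1) = ord_p(q^{|t|} − 1) ≤ ord_p(q^{2|t|} − 1) = v_p(X^{|t|} − Y^{|t|})`, then lifting
the exponent with period `r`, as `p ∣ Xʳ − Yʳ`). [folklore] -/
theorem padicValRat_zpow_sub_one_le_lte {p : ℕ} [hp : Fact p.Prime] (hp2 : p ≠ 2) {q : ℚ}
    (hq0 : q ≠ 0) (hqv : padicValRat p q = 0) (hq2 : q ^ 2 ≠ 1) {t : ℤ}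
    (hpow : q ^ (2 * t.natAbs) ≠ 1) {X Y : ℕ} (hX : X = max (q.num.natAbs ^ 2) (q.den ^ 2))
    (hY : Y = min (q.num.natAbs ^ 2) (q.den ^ 2)) :
    Y < X ∧ padicValRat p (q ^ t - 1) ≤
      (padicValNat p (X ^ orderOf (ratModP p q) - Y ^ orderOf (ratModP p q)) : ℤ) +
        padicValNat p t.natAbs := by
  have hprime : p.Prime := hp.out
  -- Step 1: `ord_p(q^t - 1) ≤ ord_p((q²)^|t| - 1)`
  have step1 : padicValRat p (q ^ t - 1) ≤ padicValRat p ((q ^ 2) ^ t.natAbs - 1) := by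
    rw [padicValRat_zpow_sub_one_eq_natAbs hq0 hqv t, ← pow_mul]
    exact padicValRat_pow_sub_one_le_sq hqv t.natAbs hpow
  -- the integers `A = |num|`, `D = den`
  obtain ⟨hpA, hpD⟩ := padicUnit_not_dvd_num_den hprime hq0 hqv
  have hD0 : q.den ≠ 0 := q.den_pos.ne'
  have hsq : q ^ 2 = ((q.num.natAbs ^ 2 : ℕ) : ℚ) / ((q.den ^ 2 : ℕ) : ℚ) := by
    have h1 : ((q.num.natAbs : ℕ) : ℚ) ^ 2 = (q.num : ℚ) ^ 2 := by
      rw [Nat.cast_natAbs, Int.cast_abs, sq_abs]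
    conv_lhs => rw [← Rat.num_div_den q]
    push_cast
    rw [div_pow, h1]
  have hAD : q.num.natAbs ^ 2 ≠ q.den ^ 2 := by
    intro h
    apply hq2
    rw [hsq, h, div_self]
    exact_mod_cast pow_ne_zero _ hD0
  have hYX : Y < X := by rw [hX, hY]; exact min_lt_max.mpr hAD
  have hpA2 : ¬ p ∣ q.num.natAbs ^ 2 := fun h => hpA (hprime.dvd_of_dvd_pow h)
  have hpD2 : ¬ p ∣ q.den ^ 2 := fun h => hpD (hprime.dvd_of_dvd_pow h)
  have hpX : ¬ p ∣ X := by
    rcases max_choice (q.num.natAbs ^ 2) (q.den ^ 2) with h | h <;> rw [hX, h] <;> assumption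
  have hpY : ¬ p ∣ Y := by
    rcases min_choice (q.num.natAbs ^ 2) (q.den ^ 2) with h | h <;> rw [hY, h] <;> assumption
  refine ⟨hYX, ?_⟩
  -- Step 2: `ord_p((q²)^n - 1) = ord_p((X/Y)^n - 1)`
  have step2 : padicValRat p ((q ^ 2) ^ t.natAbs - 1) =
      padicValRat p ((((X : ℕ) : ℚ) / Y) ^ t.natAbs - 1) := by
    rcases le_total (q.den ^ 2) (q.num.natAbs ^ 2) with h | h
    · rw [hX, hY, max_eq_left h, min_eq_right h, ← hsq]
    · have hXY : ((X : ℕ) : ℚ) / Y = (q ^ 2)⁻¹ := by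
        rw [hX, hY, max_eq_right h, min_eq_left h, hsq, inv_div]
      rw [hXY, inv_pow]
      exact (padicValRat_inv_sub_one (pow_ne_zero _ (pow_ne_zero _ hq0)) (by simp [hqv])).symm
  -- Step 3: `= v_p(X^n - Y^n)`
  have step3 := padicValRat_div_pow_sub_one_eq (p := p) hYX hpY t.natAbs
  -- Step 4: lifting the exponent with period `r = ord(q̄)`
  set r := orderOf (ratModP p q) with hr_def
  have hr0 : r ≠ 0 := (orderOf_ratModP_pos hprime hq0 hqv).ne'
  have hcong := natAbs_num_sq_pow_orderOf_eq (p := p) (q := q) hpD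
  have hdiv : p ∣ X ^ r - Y ^ r := by
    have hle : Y ^ r ≤ X ^ r := Nat.pow_le_pow_left hYX.le r
    refine (Nat.modEq_iff_dvd' hle).mp ((ZMod.natCast_eq_natCast_iff _ _ _).mp ?_)
    rcases le_total (q.den ^ 2) (q.num.natAbs ^ 2) with h | h
    · rw [hX, hY, max_eq_left h, min_eq_right h]
      exact hcong.symm
    · rw [hX, hY, max_eq_right h, min_eq_left h]
      exact hcong
  have step4 : padicValNat p (X ^ t.natAbs - Y ^ t.natAbs) ≤
      padicValNat p (X ^ r - Y ^ r) + padicValNat p t.natAbs :=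
    padicValNat_pow_sub_pow_le_of_dvd hp2 hYX hpX hr0 hdiv t.natAbs
  have h14 := step1.trans_eq (step2.trans step3)
  exact h14.trans (by exact_mod_cast step4)

/-! ### Lower bounds for Stewart's constant with one logarithm -/

/-- The prefactor estimate: `21056 · T' ≤ 376 · S · (7 E F) · G · T` whenever `S ≥ 1`, `E ≥ 2`,
`F ≥ 1`, `G ≥ 4` and `0 ≤ T' ≤ T` (`21056 = 376 · 14 · 4`). [folklore] -/
theorem stewart_prefactor_le (S E F G T T' : ℝ) (hS : 1 ≤ S) (hE : 2 ≤ E) (hF : 1 ≤ F)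
    (hG : 4 ≤ G) (hT : T' ≤ T) (hT0 : 0 ≤ T') :
    21056 * T' ≤ 376 * S * (7 * E * F) * G * T := by
  have h1 : 14 ≤ 7 * E * F := by nlinarith
  have h2 : 376 * 14 ≤ 376 * S * (7 * E * F) := by nlinarith
  have h3 : 376 * 14 * 4 ≤ 376 * S * (7 * E * F) * G := by nlinarith
  have h4 : (0 : ℝ) ≤ 376 * S * (7 * E * F) * G := by linarith
  calc 21056 * T' = 376 * 14 * 4 * T' := by norm_num
    _ ≤ 376 * S * (7 * E * F) * G * T' := mul_le_mul_of_nonneg_right h3 hT0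
    _ ≤ 376 * S * (7 * E * F) * G * T := mul_le_mul_of_nonneg_left hT h4

/-- **`C ≥ 21056 · r / log p` and `C ≥ 21056 · e · log p`** for Stewart's constant with `n = 1`,
`d = 1`, any `δ > 0` and any `0 ≤ r ≤ p/δ`. [cite: Stewart2013, Lemma 5] -/
theorem stewartC_one_ge {p : ℕ} (hp5 : 5 ≤ p) (δ : ℝ) {r : ℝ} (hr0 : 0 ≤ r)
    (hr : r ≤ (p : ℝ) / δ) :
    21056 * (r / Real.log p) ≤ stewartC 1 p δ ∧
      21056 * (Real.exp 1 * Real.log p) ≤ stewartC 1 p δ := by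
  have hp' : (5 : ℝ) ≤ p := by exact_mod_cast hp5
  have hL : 0 < Real.log p := Real.log_pos (by linarith)
  have hsqrt : (1 : ℝ) ≤ Real.sqrt (1 + 1) := by
    rw [← Real.sqrt_one]
    exact Real.sqrt_le_sqrt (by norm_num)
  have he : (2 : ℝ) ≤ Real.exp 1 := by have := Real.exp_one_gt_d9; linarith
  have hfrac : (1 : ℝ) ≤ ((p : ℝ) - 1) / ((p : ℝ) - 2) := by
    rw [le_div_iff₀ (by linarith)]
    linarith
  have hlog : (4 : ℝ) ≤ Real.log (Real.exp 4 * (1 + 1)) := by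
    rw [Real.log_mul (Real.exp_pos 4).ne' (by norm_num), Real.log_exp]
    have : (0 : ℝ) ≤ Real.log (1 + 1) := Real.log_nonneg (by norm_num)
    linarith
  have hinv : (0 : ℝ) ≤ 1 / Real.log p := one_div_nonneg.mpr hL.le
  rw [stewartC_def]
  simp only [Nat.cast_one, pow_one]
  constructor
  · refine stewart_prefactor_le _ _ _ _ _ _ hsqrt he hfrac hlog ?_ (div_nonneg hr0 hL.le)
    calc r / Real.log p = r * (1 / Real.log p) := by ring
      _ ≤ (p : ℝ) / δ * (1 / Real.log p) := mul_le_mul_of_nonneg_right hr hinv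
      _ ≤ _ := le_max_left _ _
  · refine stewart_prefactor_le _ _ _ _ _ _ hsqrt he hfrac hlog (le_max_right _ _) ?_
    have : (0 : ℝ) ≤ Real.exp 1 := (Real.exp_pos 1).le
    positivity

/-- **The arithmetic endgame** of the one-logarithm case: if `v₁ L ≤ 2 r h`, `v₂ L ≤ M`,
`C ≥ 21056 r/L`, `C ≥ 21056 e L`, `L ≥ 1`, `h ≥ 1/2`, `M ≥ 10.8`, `r ≥ 0`, then
`v₁ + v₂ < C h M`. [folklore] -/
theorem stewart_one_endgame {v₁ v₂ L h M C r : ℝ} (hL1 : 1 ≤ L) (hhalf : 1 / 2 ≤ h)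
    (hM : 10.8 ≤ M) (hr0 : 0 ≤ r) (hv1 : v₁ * L ≤ r * (2 * h)) (hv2 : v₂ * L ≤ M)
    (hC1 : 21056 * (r / L) ≤ C) (hC2 : 21056 * (Real.exp 1 * L) ≤ C) : v₁ + v₂ < C * h * M := by
  have hL0 : 0 < L := by linarith
  have hh0 : 0 ≤ h := by linarith
  have hM0 : 0 < M := by linarith
  have hHML : 0 ≤ h * M * L := mul_nonneg (mul_nonneg hh0 hM0.le) hL0.le
  have hrL : r / L * L = r := div_mul_cancel₀ r hL0.ne'
  have e1 : 21056 * r * h * M ≤ C * h * M * L := by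
    calc (21056 : ℝ) * r * h * M = 21056 * (r / L * L) * h * M := by rw [hrL]
      _ = 21056 * (r / L) * (h * M * L) := by ring
      _ ≤ C * (h * M * L) := mul_le_mul_of_nonneg_right hC1 hHML
      _ = C * h * M * L := by ring
  have e2 : 21056 * (Real.exp 1 * L) * (h * M * L) ≤ C * (h * M * L) :=
    mul_le_mul_of_nonneg_right hC2 hHML
  have hrh : 0 ≤ r * h := mul_nonneg hr0 hh0
  have e3 : 4 * (r * h) ≤ 21056 * r * h * M := by
    calc 4 * (r * h) ≤ 21056 * M * (r * h) := by
          apply mul_le_mul_of_nonneg_right _ hrh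
          linarith
      _ = 21056 * r * h * M := by ring
  have he : (2 : ℝ) ≤ Real.exp 1 := by have := Real.exp_one_gt_d9; linarith
  have g1 : (1 : ℝ) ≤ L * L := one_le_mul_of_one_le_of_one_le hL1 hL1
  have g2 : (2 : ℝ) ≤ Real.exp 1 * (L * L) := by
    calc (2 : ℝ) = 2 * 1 := by ring
      _ ≤ Real.exp 1 * (L * L) := mul_le_mul he g1 zero_le_one (Real.exp_pos 1).le
  have g3 : (1 : ℝ) ≤ Real.exp 1 * (L * L) * h := by
    calc (1 : ℝ) = 2 * (1 / 2) := by ring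
      _ ≤ Real.exp 1 * (L * L) * h :=
        mul_le_mul g2 hhalf (by norm_num) (mul_nonneg (Real.exp_pos 1).le (mul_self_nonneg L))
  have e4 : 2 * M < 21056 * (Real.exp 1 * L) * (h * M * L) := by
    have g4 : M ≤ Real.exp 1 * (L * L) * h * M := by
      calc M = 1 * M := by ring
        _ ≤ Real.exp 1 * (L * L) * h * M := mul_le_mul_of_nonneg_right g3 hM0.le
    have g5 : 21056 * (Real.exp 1 * L) * (h * M * L) = 21056 * (Real.exp 1 * (L * L) * h * M) := by
      ring
    rw [g5]
    linarith
  have s1 : v₁ * L ≤ C * h * M * L / 2 := by linarith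
  have s2 : v₂ * L < C * h * M * L / 2 := by linarith
  have hmain : (v₁ + v₂) * L < C * h * M * L := by linarith
  exact lt_of_mul_lt_mul_right hmain hL0.le

/-! ### Lemma 5 over `ℚ` with one logarithm -/

/-- **Stewart 2013, Lemma 5 over `ℚ`, `n = 1` (proved).** For a prime `p ≥ 5`, a rational
`p`-adic unit `α₁` which is not a root of unity and an integer `b₁ ≠ 0`,
`ord_p(α₁^{b₁} − 1) < C h(α₁) max(log B, 2 · 5.4)` with `C = stewartC 1 p δ`,
`δ = stewartDelta p α`, `B = max(2, |b₁|)`. Elementary (lifting the exponent); the printed lemma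
for general `n` is Yu's theorem. [cite: Stewart2013, Lemma 5 (case n = 1, K = ℚ)] -/
theorem Stewart2013_lemma5_rat_one (p : ℕ) (α : Fin 1 → ℚ) (b : Fin 1 → ℤ) (hp : p.Prime)
    (hp5 : 5 ≤ p) (hα : ∀ i, α i ≠ 0 ∧ padicValRat p (α i) = 0)
    (hind : ∀ e : Fin 1 → ℤ, ∏ i, α i ^ e i = 1 → e = 0) (hb : b ≠ 0) :
    (padicValRat p (∏ i, α i ^ b i - 1) : ℝ) <
      stewartC 1 p (stewartDelta p α) * (∏ i, logHeight₁ (α i)) *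
        max (Real.log (stewartB b)) ((1 + 1) * (5.4 * 1)) := by
  haveI := Fact.mk hp
  simp only [Fin.prod_univ_one]
  obtain ⟨hq0, hqv⟩ := hα 0
  have hp2 : p ≠ 2 := by omega
  -- `b 0 ≠ 0`
  have ht : b 0 ≠ 0 := by
    intro h0
    apply hb
    funext i
    rw [Fin.fin_one_eq_zero i]
    simpa using h0
  -- powers of `α 0` equal to `1` have exponent `0`
  have hpow : ∀ k : ℕ, α 0 ^ k = 1 → k = 0 := by
    intro k hk
    have h := hind (fun _ => (k : ℤ)) (by simp only [Fin.prod_univ_one, zpow_natCast]; exact hk)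
    have h0 := congr_fun h 0
    simpa using h0
  have hq2 : α 0 ^ 2 ≠ 1 := fun h => two_ne_zero (hpow 2 h)
  have hn : (b 0).natAbs ≠ 0 := Int.natAbs_ne_zero.mpr ht
  have hq2n : α 0 ^ (2 * (b 0).natAbs) ≠ 1 := fun h => by have := hpow _ h; omega
  -- the elementary chain
  set A := (α 0).num.natAbs with hA_def
  set D := (α 0).den with hD_def
  set X := max (A ^ 2) (D ^ 2) with hX_def
  set Y := min (A ^ 2) (D ^ 2) with hY_def
  set r := orderOf (ratModP p (α 0)) with hr_def
  obtain ⟨hYX, hZ⟩ := padicValRat_zpow_sub_one_le_lte (p := p) hp2 hq0 hqv hq2 hq2n hX_def hY_def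
  have hchain : (padicValRat p (α 0 ^ b 0 - 1) : ℝ) ≤
      (padicValNat p (X ^ r - Y ^ r) : ℝ) + (padicValNat p (b 0).natAbs : ℝ) := by
    have hZ' := (Int.cast_le (R := ℝ)).mpr hZ
    simp only [Int.cast_add, Int.cast_natCast] at hZ'
    exact hZ'
  have hA0 : A ≠ 0 := Int.natAbs_ne_zero.mpr (Rat.num_ne_zero.mpr hq0)
  have hD0 : D ≠ 0 := (α 0).den_pos.ne'
  have hAD : A ≠ D := by
    intro h
    rw [hX_def, hY_def, h] at hYX
    exact (min_lt_max.mp hYX) rfl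
  have hX0 : X ≠ 0 := by
    have : 0 < X := lt_of_le_of_lt (Nat.zero_le _) hYX
    exact this.ne'
  have hr0 : r ≠ 0 := (orderOf_ratModP_pos hp hq0 hqv).ne'
  -- sizes: `v_p(X^r - Y^r) log p ≤ 2 r h`, `v_p(|b 0|) log p ≤ log B ≤ M`
  set L := Real.log p with hL_def
  set h := logHeight₁ (α 0) with hh_def
  have hp5' : (5 : ℝ) ≤ p := by exact_mod_cast hp5
  have hL1 : 1 ≤ L := by
    rw [hL_def, Real.le_log_iff_exp_le (by linarith)]
    have := Real.exp_one_lt_d9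
    linarith
  have hhmax : h = Real.log ((max A D : ℕ) : ℝ) := by rw [hh_def, Rat.logHeight₁_eq_log_max]
  have hmax2 : 2 ≤ max A D := by
    rcases le_total A D with hle | hle
    · rw [max_eq_right hle]; omega
    · rw [max_eq_left hle]; omega
  have hh2 : Real.log 2 ≤ h := by
    rw [hhmax]
    exact Real.log_le_log two_pos (by exact_mod_cast hmax2)
  have hhalf : 1 / 2 ≤ h := by have := Real.log_two_gt_d9; linarith
  have hlogX : Real.log X ≤ 2 * h := by
    have hXle : X ≤ (max A D) ^ 2 :=
      max_le (Nat.pow_le_pow_left (le_max_left _ _) 2) (Nat.pow_le_pow_left (le_max_right _ _) 2)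
    have hXle' : (X : ℝ) ≤ ((max A D : ℕ) : ℝ) ^ 2 := by exact_mod_cast hXle
    have hX0' : (0 : ℝ) < X := by exact_mod_cast Nat.pos_of_ne_zero hX0
    have hlp : Real.log (((max A D : ℕ) : ℝ) ^ 2) = 2 * Real.log ((max A D : ℕ) : ℝ) := by
      rw [Real.log_pow]; norm_num
    rw [hhmax, ← hlp]
    exact Real.log_le_log hX0' hXle'
  have hv1 : (padicValNat p (X ^ r - Y ^ r) : ℝ) * L ≤ r * (2 * h) := by
    have hlt : Y ^ r < X ^ r := Nat.pow_lt_pow_left hYX hr0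
    have hN0 : X ^ r - Y ^ r ≠ 0 := Nat.sub_ne_zero_of_lt hlt
    refine (padicValNat_mul_log_le hp hN0).trans ?_
    have h1 : Real.log ((X ^ r - Y ^ r : ℕ) : ℝ) ≤ Real.log ((X ^ r : ℕ) : ℝ) :=
      Real.log_le_log (by exact_mod_cast Nat.sub_pos_of_lt hlt) (by exact_mod_cast Nat.sub_le _ _)
    refine h1.trans ?_
    push_cast
    rw [Real.log_pow]
    have hr0' : (0 : ℝ) ≤ r := Nat.cast_nonneg r
    nlinarith
  have hB : (b 0).natAbs ≤ stewartB b := natAbs_le_stewartB b 0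
  have hM : (10.8 : ℝ) ≤ max (Real.log (stewartB b)) ((1 + 1) * (5.4 * 1)) :=
    le_max_of_le_right (by norm_num)
  have hv2 : (padicValNat p (b 0).natAbs : ℝ) * L ≤ max (Real.log (stewartB b)) ((1 + 1) * (5.4 * 1)) := by
    refine (padicValNat_mul_log_le hp hn).trans ?_
    refine le_trans ?_ (le_max_left _ _)
    exact Real.log_le_log (by exact_mod_cast Nat.pos_of_ne_zero hn) (by exact_mod_cast hB)
  -- the constant
  have hr0' : (0 : ℝ) ≤ r := Nat.cast_nonneg r
  have hrδ : (r : ℝ) ≤ (p : ℝ) / stewartDelta p α := orderOf_ratModP_le_div_stewartDelta hp hα 0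
  obtain ⟨hC1, hC2⟩ := stewartC_one_ge hp5 (stewartDelta p α) hr0' hrδ
  exact lt_of_le_of_lt hchain (stewart_one_endgame hL1 hhalf hM hr0' hv1 hv2 hC1 hC2)

/-- **Stewart 2013, Lemma 5 over `ℚ` for `n ≤ 1` (proved):** the PRINTED statement of Lemma 5 over
`ℚ` (`max(log B, (n+1) · 5.4n)`) restricted to at most one logarithm — vacuous for `n = 0` (`b ≠ 0`
is impossible) and `Stewart2013_lemma5_rat_one` for `n = 1`. It implies the named fact
`Stewart2013_lemma5_rat` for `n ≤ 1` (`(n+1) · 5.4n ≤ G₁^ℚ(n)`, `printed_le_yuG1Rat`; used in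
`Stewart2013_lemma5_rat_of_yuBound`). The fact for `n ≥ 2` is Yu's theorem and remains
undischarged. [cite: Stewart2013, Lemma 5 (case n ≤ 1, K = ℚ)] -/
theorem Stewart2013_lemma5_rat_of_le_one (n p : ℕ) (hn : n ≤ 1) (α : Fin n → ℚ) (b : Fin n → ℤ)
    (hp : p.Prime) (hp5 : 5 ≤ p) (hα : ∀ i, α i ≠ 0 ∧ padicValRat p (α i) = 0)
    (hind : ∀ e : Fin n → ℤ, ∏ i, α i ^ e i = 1 → e = 0) (hb : b ≠ 0) :
    (padicValRat p (∏ i, α i ^ b i - 1) : ℝ) <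
      stewartC n p (stewartDelta p α) * (∏ i, logHeight₁ (α i)) *
        max (Real.log (stewartB b)) ((n + 1) * (5.4 * n)) := by
  obtain rfl | rfl : n = 0 ∨ n = 1 := by omega
  · exact absurd (Subsingleton.elim b 0) hb
  · have h := Stewart2013_lemma5_rat_one p α b hp hp5 hα hind hb
    simpa using h

/-! ### The explicit one-logarithm estimate over `ℚ` -/

/-- A rational number other than `0, 1, −1` has no power equal to `1`. [folklore] -/
theorem rat_pow_ne_one_of_ne_one {q : ℚ} (hq1 : q ≠ 1) (hqm1 : q ≠ -1) {m : ℕ} (hm : m ≠ 0) :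
    q ^ m ≠ 1 := by
  intro h
  have habs : |q| ^ m = 1 := by rw [← abs_pow, h, abs_one]
  have h1 : |q| = 1 := (pow_eq_one_iff_of_nonneg (abs_nonneg q) hm).mp habs
  rcases (abs_eq zero_le_one).mp h1 with h | h
  · exact hq1 h
  · exact hqm1 h

/-- **The elementary one-logarithm estimate over `ℚ`.** For an odd prime `p`, a rational `p`-adic
unit `q ∉ {0, 1, −1}`, an integer `t ≠ 0` and `r` the order of the reduction `q̄` in `(ℤ/pℤ)ˣ`,
`ord_p(qᵗ − 1) · log p ≤ 2 r h(q) + log |t|` (`h` the absolute logarithmic Weil height); by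
lifting the exponent (`padicValRat_zpow_sub_one_le_lte`) and `p^{v_p(N)} ≤ N`. This is the shape of
the trivial bound for a single `p`-adic logarithm (linear in the order `r ≤ p − 1`, logarithmic in
`|t|`). [folklore] -/
theorem padicValRat_zpow_sub_one_mul_log_le {p : ℕ} (hp : p.Prime) (hp2 : p ≠ 2) {q : ℚ}
    (hq0 : q ≠ 0) (hqv : padicValRat p q = 0) (hq1 : q ≠ 1) (hqm1 : q ≠ -1) {t : ℤ} (ht : t ≠ 0) :
    (padicValRat p (q ^ t - 1) : ℝ) * Real.log p ≤
      2 * orderOf (ratModP p q) * logHeight₁ q + Real.log (t.natAbs : ℝ) := by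
  haveI := Fact.mk hp
  have hn : t.natAbs ≠ 0 := Int.natAbs_ne_zero.mpr ht
  have hq2 : q ^ 2 ≠ 1 := rat_pow_ne_one_of_ne_one hq1 hqm1 two_ne_zero
  have hq2n : q ^ (2 * t.natAbs) ≠ 1 := rat_pow_ne_one_of_ne_one hq1 hqm1 (by omega)
  set A := q.num.natAbs with hA_def
  set D := q.den with hD_def
  set X := max (A ^ 2) (D ^ 2) with hX_def
  set Y := min (A ^ 2) (D ^ 2) with hY_def
  set r := orderOf (ratModP p q) with hr_def
  obtain ⟨hYX, hZ⟩ := padicValRat_zpow_sub_one_le_lte (p := p) hp2 hq0 hqv hq2 hq2n hX_def hY_def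
  have hchain : (padicValRat p (q ^ t - 1) : ℝ) ≤
      (padicValNat p (X ^ r - Y ^ r) : ℝ) + (padicValNat p t.natAbs : ℝ) := by
    have hZ' := (Int.cast_le (R := ℝ)).mpr hZ
    simp only [Int.cast_add, Int.cast_natCast] at hZ'
    exact hZ'
  have hX0 : X ≠ 0 := (lt_of_le_of_lt (Nat.zero_le _) hYX).ne'
  have hr0 : r ≠ 0 := (orderOf_ratModP_pos hp hq0 hqv).ne'
  have hL0 : 0 < Real.log p := Real.log_pos (by exact_mod_cast hp.one_lt)
  -- `log X ≤ 2 h(q)`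
  have hhmax : logHeight₁ q = Real.log ((max A D : ℕ) : ℝ) := by rw [Rat.logHeight₁_eq_log_max]
  have hlogX : Real.log X ≤ 2 * logHeight₁ q := by
    have hXle : X ≤ (max A D) ^ 2 :=
      max_le (Nat.pow_le_pow_left (le_max_left _ _) 2) (Nat.pow_le_pow_left (le_max_right _ _) 2)
    have hXle' : (X : ℝ) ≤ ((max A D : ℕ) : ℝ) ^ 2 := by exact_mod_cast hXle
    have hX0' : (0 : ℝ) < X := by exact_mod_cast Nat.pos_of_ne_zero hX0
    have hlp : Real.log (((max A D : ℕ) : ℝ) ^ 2) = 2 * Real.log ((max A D : ℕ) : ℝ) := by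
      rw [Real.log_pow]; norm_num
    rw [hhmax, ← hlp]
    exact Real.log_le_log hX0' hXle'
  -- `v_p(X^r - Y^r) log p ≤ r log X`
  have hv1 : (padicValNat p (X ^ r - Y ^ r) : ℝ) * Real.log p ≤ r * (2 * logHeight₁ q) := by
    have hlt : Y ^ r < X ^ r := Nat.pow_lt_pow_left hYX hr0
    have hN0 : X ^ r - Y ^ r ≠ 0 := Nat.sub_ne_zero_of_lt hlt
    refine (padicValNat_mul_log_le hp hN0).trans ?_
    have h1 : Real.log ((X ^ r - Y ^ r : ℕ) : ℝ) ≤ Real.log ((X ^ r : ℕ) : ℝ) :=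
      Real.log_le_log (by exact_mod_cast Nat.sub_pos_of_lt hlt) (by exact_mod_cast Nat.sub_le _ _)
    refine h1.trans ?_
    push_cast
    rw [Real.log_pow]
    have hr0' : (0 : ℝ) ≤ r := Nat.cast_nonneg r
    nlinarith
  -- `v_p(|t|) log p ≤ log |t|`
  have hv2 : (padicValNat p t.natAbs : ℝ) * Real.log p ≤ Real.log (t.natAbs : ℝ) :=
    padicValNat_mul_log_le hp hn
  calc (padicValRat p (q ^ t - 1) : ℝ) * Real.log p
      ≤ ((padicValNat p (X ^ r - Y ^ r) : ℝ) + (padicValNat p t.natAbs : ℝ)) * Real.log p :=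
        mul_le_mul_of_nonneg_right hchain hL0.le
    _ = (padicValNat p (X ^ r - Y ^ r) : ℝ) * Real.log p +
          (padicValNat p t.natAbs : ℝ) * Real.log p := by ring
    _ ≤ r * (2 * logHeight₁ q) + Real.log (t.natAbs : ℝ) := add_le_add hv1 hv2
    _ = 2 * r * logHeight₁ q + Real.log (t.natAbs : ℝ) := by ring

/-- The same estimate with the order `r` replaced by `p − 1` (`r ≤ |𝔽_pˣ| = p − 1`):
`ord_p(qᵗ − 1) · log p ≤ 2 (p − 1) h(q) + log |t|`. [folklore] -/
theorem padicValRat_zpow_sub_one_mul_log_le' {p : ℕ} (hp : p.Prime) (hp2 : p ≠ 2) {q : ℚ}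
    (hq0 : q ≠ 0) (hqv : padicValRat p q = 0) (hq1 : q ≠ 1) (hqm1 : q ≠ -1) {t : ℤ} (ht : t ≠ 0) :
    (padicValRat p (q ^ t - 1) : ℝ) * Real.log p ≤
      2 * ((p : ℝ) - 1) * logHeight₁ q + Real.log (t.natAbs : ℝ) := by
  haveI := Fact.mk hp
  have h := padicValRat_zpow_sub_one_mul_log_le hp hp2 hq0 hqv hq1 hqm1 ht
  obtain ⟨u, hu⟩ := isUnit_ratModP hp hq0 hqv
  have hr : orderOf (ratModP p q) ≤ p - 1 := by
    rw [← hu, orderOf_units, ← ZMod.card_units p]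
    exact orderOf_le_card_univ
  have hr' : (orderOf (ratModP p q) : ℝ) ≤ (p : ℝ) - 1 := by
    have : ((p - 1 : ℕ) : ℝ) = (p : ℝ) - 1 := by rw [Nat.cast_sub hp.one_lt.le, Nat.cast_one]
    rw [← this]
    exact_mod_cast hr
  have hh0 : 0 ≤ logHeight₁ q := zero_le_logHeight₁ q
  nlinarith

/-! ### Numerical bounds for `log 7`, `exp 2` and `log 28.95` -/

/-- `1.9 < log 7` (`e^{19} < 7^{10}`). [folklore] -/
theorem log_seven_gt_d1 : (1.9 : ℝ) < Real.log 7 := by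
  rw [Real.lt_log_iff_exp_lt (by norm_num)]
  have h10 : Real.exp 1.9 ^ 10 = Real.exp 19 := by rw [← Real.exp_nat_mul]; norm_num
  have hexp19 : Real.exp 19 < (7 : ℝ) ^ 10 := by
    calc Real.exp 19 = Real.exp 1 ^ 19 := by rw [Real.exp_one_pow]; norm_num
      _ < 2.7182818286 ^ 19 := by gcongr; exact Real.exp_one_lt_d9
      _ < 7 ^ 10 := by norm_num
  have h : Real.exp 1.9 ^ 10 < (7 : ℝ) ^ 10 := by rw [h10]; exact hexp19
  exact lt_of_pow_lt_pow_left₀ 10 (by norm_num) h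

/-- `log 7 < 1.95` (`7^{20} < e^{39}`). [folklore] -/
theorem log_seven_lt_d2 : Real.log 7 < 1.95 := by
  rw [Real.log_lt_iff_lt_exp (by norm_num)]
  have h20 : Real.exp 1.95 ^ 20 = Real.exp 39 := by rw [← Real.exp_nat_mul]; norm_num
  have hexp39 : (7 : ℝ) ^ 20 < Real.exp 39 := by
    calc (7 : ℝ) ^ 20 < 2.7182818283 ^ 39 := by norm_num
      _ < Real.exp 1 ^ 39 := by gcongr; exact Real.exp_one_gt_d9
      _ = Real.exp 39 := by rw [Real.exp_one_pow]; norm_num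
  have h : (7 : ℝ) ^ 20 < Real.exp 1.95 ^ 20 := by rw [h20]; exact hexp39
  exact lt_of_pow_lt_pow_left₀ 20 (Real.exp_pos _).le h

/-- `exp 2 < 7.39`. [folklore] -/
theorem exp_two_lt_d2 : Real.exp 2 < 7.39 := by
  calc Real.exp 2 = Real.exp 1 ^ 2 := by rw [Real.exp_one_pow]; norm_num
    _ < 2.7182818286 ^ 2 := by gcongr; exact Real.exp_one_lt_d9
    _ < 7.39 := by norm_num

/-- `log 28.95 < 3.4` (`28.95^5 < e^{17}`). [folklore] -/
theorem log_d2895_lt : Real.log 28.95 < 3.4 := by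
  rw [Real.log_lt_iff_lt_exp (by norm_num)]
  have h5 : Real.exp 3.4 ^ 5 = Real.exp 17 := by rw [← Real.exp_nat_mul]; norm_num
  have h17 : (28.95 : ℝ) ^ 5 < Real.exp 17 := by
    calc (28.95 : ℝ) ^ 5 < 2.7182818283 ^ 17 := by norm_num
      _ < Real.exp 1 ^ 17 := by gcongr; exact Real.exp_one_gt_d9
      _ = Real.exp 17 := by rw [Real.exp_one_pow]; norm_num
  have h : (28.95 : ℝ) ^ 5 < Real.exp 3.4 ^ 5 := by rw [h5]; exact h17
  exact lt_of_pow_lt_pow_left₀ 5 (Real.exp_pos _).le h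

/-! ### The printed step (19) of Stewart's proof for `d = 1`: `G₁ ≤ (n+1)(5.4 n)` iff `n ≥ 6` -/

/-- **The step "`G₁ ≤ (n+1)(5.4n + log d)`" of the printed proof FAILS for `1 ≤ n ≤ 5`
(`d = 1`).** With `G₁ = (n+1)((2 + log 7)n + 5.25 + log((2 + log 7)n + 5.25) + log d)` as printed
(arXiv:1008.1274, p. 8, display after (17)), for `d = 1` and `1 ≤ n ≤ 5` one has
`(n+1) · 5.4 n < G₁`: numerically `G₁/(n+1) = 11.41, 15.72, 19.93, 24.08, 28.20` against
`5.4 n = 5.4, 10.8, 16.2, 21.6, 27`. Consequently the printed derivation of Lemma 5 from Yu's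
Main Theorem yields, for `2 ≤ n ≤ 5`, only the bound with `max(log B, G₁)` in place of
`max(log B, (n+1)(5.4n + log d))`; the statement of Lemma 5 for these `n` is printed but not
established by the printed argument (for `n = 1`, `K = ℚ` it is proved unconditionally in this
file, `Stewart2013_lemma5_rat_one`). [cite: Stewart2013, proof of Lemma 5, (17)–(19)] -/
theorem stewart_G1_gt {n : ℕ} (hn1 : 1 ≤ n) (hn5 : n ≤ 5) :
    ((n : ℝ) + 1) * (5.4 * n) <
      ((n : ℝ) + 1) *
        ((2 + Real.log 7) * n + 5.25 + Real.log ((2 + Real.log 7) * n + 5.25)) := by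
  have hn0 : (0 : ℝ) < n + 1 := by positivity
  apply mul_lt_mul_of_pos_left _ hn0
  have ha : (1.9 : ℝ) < Real.log 7 := log_seven_gt_d1
  have hnR1 : (1 : ℝ) ≤ n := by exact_mod_cast hn1
  set x := (2 + Real.log 7) * n + 5.25 with hx
  have hxn : 3.9 * (n : ℝ) + 5.25 < x := by rw [hx]; nlinarith
  have hx9 : (9.15 : ℝ) < x := by linarith
  have hlog2 : (2 : ℝ) < Real.log x := by
    rw [Real.lt_log_iff_exp_lt (by linarith)]
    linarith [exp_two_lt_d2]
  rcases Nat.lt_or_ge 4 n with h5 | h4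
  swap
  · have hnR4 : (n : ℝ) ≤ 4 := by exact_mod_cast h4
    linarith
  · have hn5' : n = 5 := by omega
    subst hn5'
    have hx24 : (24.75 : ℝ) < x := by
      have : (3.9 : ℝ) * ((5 : ℕ) : ℝ) + 5.25 = 24.75 := by norm_num
      linarith
    have hexp3 : Real.exp 3 < 20.1 := by
      -- (the same numerical fact is `Literature.NumberTheory.Sieve.JurkatRichert.exp_three_lt`)
      calc Real.exp 3 = Real.exp 1 ^ 3 := by rw [Real.exp_one_pow]; norm_num
        _ < 2.7182818286 ^ 3 := by gcongr; exact Real.exp_one_lt_d9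
        _ < 20.1 := by norm_num
    have hlog3 : (3 : ℝ) < Real.log x := by
      rw [Real.lt_log_iff_exp_lt (by linarith)]
      linarith
    have : (5.4 : ℝ) * ((5 : ℕ) : ℝ) = 27 := by norm_num
    linarith

/-- **The step "`G₁ ≤ (n+1)(5.4n + log d)`" of the printed proof HOLDS for `n ≥ 6` (`d = 1`):**
`(n+1)((2 + log 7)n + 5.25 + log((2 + log 7)n + 5.25)) ≤ (n+1) · 5.4 n` for `6 ≤ n`
(`log 7 < 1.95`, `log 28.95 < 3.4` and concavity `log y ≤ log y₀ + y/y₀ − 1`; at `n = 6` the two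
sides are `32.29… · 7` and `32.4 · 7`). So the printed derivation (17)–(19) of Lemma 5 from Yu's
Main Theorem is arithmetically sound exactly for `n ≥ 6`.
[cite: Stewart2013, proof of Lemma 5, (19)] -/
theorem stewart_G1_le {n : ℕ} (hn : 6 ≤ n) :
    ((n : ℝ) + 1) *
        ((2 + Real.log 7) * n + 5.25 + Real.log ((2 + Real.log 7) * n + 5.25)) ≤
      ((n : ℝ) + 1) * (5.4 * n) := by
  have hn0 : (0 : ℝ) ≤ n + 1 := by positivity
  apply mul_le_mul_of_nonneg_left _ hn0
  have ha : (1.9 : ℝ) < Real.log 7 := log_seven_gt_d1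
  have hb : Real.log 7 < 1.95 := log_seven_lt_d2
  have hnR : (6 : ℝ) ≤ n := by exact_mod_cast hn
  set x := (2 + Real.log 7) * n + 5.25 with hx
  have hxlo : 3.9 * (n : ℝ) + 5.25 < x := by rw [hx]; nlinarith
  have hxup : x < 3.95 * (n : ℝ) + 5.25 := by rw [hx]; nlinarith
  have hx0 : (0 : ℝ) < x := by linarith
  have hlogx : Real.log x ≤ Real.log 28.95 + (x / 28.95 - 1) := by
    have hsplit : Real.log x = Real.log 28.95 + Real.log (x / 28.95) := by
      rw [← Real.log_mul (by norm_num) (by positivity)]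
      congr 1
      field_simp
    rw [hsplit]
    have := Real.log_le_sub_one_of_pos (show 0 < x / 28.95 by positivity)
    linarith
  have h2895 := log_d2895_lt
  have hdiv : x / 28.95 < (3.95 * (n : ℝ) + 5.25) / 28.95 := by gcongr
  have hfin : x + Real.log x < 3.95 * n + 5.25 + 3.4 + ((3.95 * n + 5.25) / 28.95 - 1) := by
    linarith
  have hkey : 3.95 * (n : ℝ) + 5.25 + 3.4 + ((3.95 * n + 5.25) / 28.95 - 1) ≤ 5.4 * n := by
    field_simp
    nlinarith
  linarith


/-! ### The Liouville (trivial) estimate for `ord_p(α₁^{b₁}⋯αₙ^{bₙ} − 1)` over `ℚ` -/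

/-- **Liouville estimate for `Ξ − 1`, `Ξ = α₁^{b₁}⋯αₙ^{bₙ} ∈ ℚ`.** For a prime `p` and
`Ξ ≠ 1`: `ord_p(Ξ − 1) · log p ≤ log 2 + ∑ᵢ |bᵢ| h(αᵢ)` (`h = logHeight₁`): indeed
`ord_p(z) log p ≤ h(z)` for `z ∈ ℚˣ` (`padicValRat_mul_log_le_logHeight₁`), `h(Ξ − 1) ≤ log 2 + h(Ξ)`
and `h(∏ αᵢ^{bᵢ}) ≤ ∑ |bᵢ| h(αᵢ)`. This is the trivial ("Liouville") upper bound, linear in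
`B = max |bᵢ|`, against which Lemma 5 (logarithmic in `B`) is measured. [folklore] -/
theorem padicValRat_prod_zpow_sub_one_mul_log_le {p : ℕ} (hp : p.Prime) {n : ℕ} (α : Fin n → ℚ)
    (b : Fin n → ℤ) (hΞ : ∏ i, α i ^ b i ≠ 1) :
    (padicValRat p (∏ i, α i ^ b i - 1) : ℝ) * Real.log p ≤
      Real.log 2 + ∑ i, ((b i).natAbs : ℝ) * logHeight₁ (α i) := by
  set Ξ := ∏ i, α i ^ b i with hΞdef
  have hz : Ξ - 1 ≠ 0 := sub_ne_zero.mpr hΞ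
  have h1 : (padicValRat p (Ξ - 1) : ℝ) * Real.log p ≤ logHeight₁ (Ξ - 1) :=
    padicValRat_mul_log_le_logHeight₁ p hp hz
  have h2 : logHeight₁ (Ξ - 1) ≤ Real.log 2 + logHeight₁ Ξ := by
    have h := logHeight₁_one_sub_le Ξ
    rwa [← logHeight₁_neg, neg_sub] at h
  have h3 : logHeight₁ Ξ ≤ ∑ i, ((b i).natAbs : ℝ) * logHeight₁ (α i) := by
    calc logHeight₁ Ξ ≤ ∑ i, logHeight₁ (α i ^ b i) := logHeight₁_prod_le _ _
      _ = ∑ i, ((b i).natAbs : ℝ) * logHeight₁ (α i) := by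
        refine Finset.sum_congr rfl fun i _ => ?_
        rw [logHeight₁_zpow]
  linarith

/-- Multiplicatively independent `αᵢ` are `≠ 1` and `≠ −1` (test with `e = δᵢ`, `e = 2δᵢ`).
[folklore] -/
theorem ne_one_and_ne_neg_one_of_multIndep {n : ℕ} {α : Fin n → ℚ}
    (hind : ∀ e : Fin n → ℤ, ∏ i, α i ^ e i = 1 → e = 0) (i : Fin n) :
    α i ≠ 1 ∧ α i ≠ -1 := by
  have key : ∀ (k : ℤ), k ≠ 0 → α i ^ k ≠ 1 := by
    intro k hk hpow
    have hprod : ∏ j, α j ^ (Pi.single i k : Fin n → ℤ) j = 1 := by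
      rw [Fintype.prod_eq_single i (fun j hj => by rw [Pi.single_eq_of_ne hj, zpow_zero])]
      rw [Pi.single_eq_same, hpow]
    have h0 := congr_fun (hind _ hprod) i
    rw [Pi.single_eq_same, Pi.zero_apply] at h0
    exact hk h0
  refine ⟨fun h => key 1 one_ne_zero (by rw [h, one_zpow]), fun h => key 2 two_ne_zero ?_⟩
  rw [h]
  norm_num

/-- `hᵢ · c^{n-1} ≤ ∏ⱼ hⱼ` when `0 ≤ c ≤ hⱼ` for all `j`. [folklore] -/
theorem mul_pow_pred_le_prod {n : ℕ} (h : Fin n → ℝ) {c : ℝ} (hc : 0 ≤ c) (hch : ∀ j, c ≤ h j)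
    (i : Fin n) : h i * c ^ (n - 1) ≤ ∏ j, h j := by
  have hsplit : ∏ j, h j = h i * ∏ j ∈ univ.erase i, h j :=
    (Finset.mul_prod_erase univ h (mem_univ i)).symm
  have hcard : (univ.erase i).card = n - 1 := by
    rw [Finset.card_erase_of_mem (mem_univ i), card_univ, Fintype.card_fin]
  have hprod : c ^ (n - 1) ≤ ∏ j ∈ univ.erase i, h j := by
    rw [← hcard, ← Finset.prod_const]
    exact Finset.prod_le_prod (fun _ _ => hc) fun j _ => hch j
  rw [hsplit]
  exact mul_le_mul_of_nonneg_left hprod (hc.trans (hch i))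

/-- The prefactor estimate for general `n`: `1504 · X' · T' ≤ 376 · S · X · G · T` whenever
`S ≥ 1`, `0 ≤ X' ≤ X`, `G ≥ 4` and `0 ≤ T' ≤ T` (`1504 = 376 · 4`). [folklore] -/
theorem stewart_prefactor_le' (S X X' G T T' : ℝ) (hS : 1 ≤ S) (hX : X' ≤ X) (hX0 : 0 ≤ X')
    (hG : 4 ≤ G) (hT : T' ≤ T) (hT0 : 0 ≤ T') :
    1504 * X' * T' ≤ 376 * S * X * G * T := by
  have h1 : X' ≤ S * X := by nlinarith
  have h2 : (0 : ℝ) ≤ 376 * S * X := by nlinarith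
  have h3 : 376 * 4 * X' ≤ 376 * S * X * G := by nlinarith
  have h4 : (0 : ℝ) ≤ 376 * S * X * G := by nlinarith
  calc 1504 * X' * T' = 376 * 4 * X' * T' := by norm_num
    _ ≤ 376 * S * X * G * T' := mul_le_mul_of_nonneg_right h3 hT0
    _ ≤ 376 * S * X * G * T := mul_le_mul_of_nonneg_left hT h4

/-- **`C ≥ 1504 · (7e)ⁿ eⁿ · log p`** for Stewart's constant with `d = 1`, any `n`, `p ≥ 5` and
any `δ` (`√(n+1) ≥ 1`, `(p−1)/(p−2) ≥ 1`, `log(e⁴(n+1)) ≥ 4`, `max(·, eⁿ log p) ≥ eⁿ log p`).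
[cite: Stewart2013, Lemma 5] -/
theorem stewartC_ge (n : ℕ) {p : ℕ} (hp5 : 5 ≤ p) (δ : ℝ) :
    1504 * ((7 * Real.exp 1) ^ n * Real.exp 1 ^ n) * Real.log p ≤ stewartC n p δ := by
  have hp' : (5 : ℝ) ≤ p := by exact_mod_cast hp5
  have hL : 0 < Real.log p := Real.log_pos (by linarith)
  have hE : 0 < Real.exp 1 := Real.exp_pos 1
  have hsqrt : (1 : ℝ) ≤ Real.sqrt (n + 1) :=
    Real.one_le_sqrt.mpr (by have : (0:ℝ) ≤ n := Nat.cast_nonneg n; linarith)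
  have hfrac : (1 : ℝ) ≤ ((p : ℝ) - 1) / ((p : ℝ) - 2) := by
    rw [le_div_iff₀ (by linarith)]
    linarith
  have hpow : (7 * Real.exp 1) ^ n ≤ (7 * Real.exp 1 * (((p : ℝ) - 1) / ((p : ℝ) - 2))) ^ n :=
    pow_le_pow_left₀ (by positivity) (le_mul_of_one_le_right (by positivity) hfrac) n
  have hlog : (4 : ℝ) ≤ Real.log (Real.exp 4 * (n + 1)) := by
    rw [Real.log_mul (Real.exp_pos 4).ne' (by positivity), Real.log_exp]
    have : (0 : ℝ) ≤ Real.log (n + 1) :=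
      Real.log_nonneg (by have : (0:ℝ) ≤ n := Nat.cast_nonneg n; linarith)
    linarith
  rw [stewartC_def]
  calc 1504 * ((7 * Real.exp 1) ^ n * Real.exp 1 ^ n) * Real.log p
      = 1504 * (7 * Real.exp 1) ^ n * (Real.exp 1 ^ n * Real.log p) := by ring
    _ ≤ _ := stewart_prefactor_le' _ _ _ _ _ _ hsqrt hpow (by positivity) hlog
          (by rw [Real.exp_one_pow]; exact le_max_right _ _) (mul_nonneg (pow_nonneg hE.le n) hL.le)

/-- `1.6 < log 5` (`e^8 < 5^5`). [folklore] -/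
theorem log_five_gt_d1 : (1.6 : ℝ) < Real.log 5 := by
  rw [Real.lt_log_iff_exp_lt (by norm_num)]
  have h5 : Real.exp 1.6 ^ 5 = Real.exp 8 := by rw [← Real.exp_nat_mul]; norm_num
  have hexp8 : Real.exp 8 < (5 : ℝ) ^ 5 := by
    calc Real.exp 8 = Real.exp 1 ^ 8 := by rw [Real.exp_one_pow]; norm_num
      _ < 2.7182818286 ^ 8 := by gcongr; exact Real.exp_one_lt_d9
      _ < 5 ^ 5 := by norm_num
  have h : Real.exp 1.6 ^ 5 < (5 : ℝ) ^ 5 := by rw [h5]; exact hexp8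
  exact lt_of_pow_lt_pow_left₀ 5 (by norm_num) h

/-- `(7e)ⁿ eⁿ (log 2)^{n−1} ≥ 1853` for `n ≥ 2` (`7e² > 51.72`, `7e² log 2 > 35.84`). [folklore] -/
theorem stewart_geom_factor_ge {n : ℕ} (hn : 2 ≤ n) :
    (1853 : ℝ) ≤ (7 * Real.exp 1) ^ n * Real.exp 1 ^ n * Real.log 2 ^ (n - 1) := by
  obtain ⟨m, rfl⟩ : ∃ m, n = m + 1 := ⟨n - 1, by omega⟩
  have hm : m ≠ 0 := by omega
  set E := Real.exp 1 with hE
  set l := Real.log 2 with hl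
  have hE1 : 2.7182818283 < E := Real.exp_one_gt_d9
  have hl1 : 0.6931471803 < l := Real.log_two_gt_d9
  have hE2 : (51.72 : ℝ) < 7 * E * E := by nlinarith
  have hQ : (35.84 : ℝ) < 7 * E * E * l := by nlinarith
  have hQ1 : (1 : ℝ) ≤ 7 * E * E * l := by linarith
  have hQm : 7 * E * E * l ≤ (7 * E * E * l) ^ m := le_self_pow₀ hQ1 hm
  have hid : (7 * E) ^ (m + 1) * E ^ (m + 1) * l ^ (m + 1 - 1) =
      (7 * E * E * l) ^ m * (7 * E * E) := by
    rw [Nat.add_sub_cancel]; ring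
  rw [hid]
  have h := mul_le_mul (hQ.le.trans hQm) hE2.le (by norm_num) (le_trans (by norm_num) (hQ.le.trans hQm))
  linarith

/-- **Lemma 5 over `ℚ` in the Liouville range (proved): all `n`, `B ≤ 10⁸`.** Under the
hypotheses of `Stewart2013_lemma5_rat` and `B = max(2, |bᵢ|) ≤ 10⁸` the PRINTED conclusion
(`max(log B, (n+1) · 5.4n)`) holds — for
`n ≤ 1` unconditionally (`Stewart2013_lemma5_rat_of_le_one`), and for `n ≥ 2` because the trivial
estimate `ord_p(Ξ − 1) log p ≤ log 2 + B ∑ h(αᵢ) ≤ (1 + nB) ∏ h(αᵢ)/(log 2)^{n−1}` (each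
`h(αᵢ) ≥ log 2`, Voutier/Evertse–Győry Prop. 3.2.9 over `ℚ`) is below
`C ∏ h(αᵢ) · 5.4 n(n+1) · log p` with `C ≥ 1504 (7e²)ⁿ log p` as soon as
`1 + nB < 1504 · 5.4 · n(n+1) (7e²)ⁿ (log 2)^{n−1} (log p)²`, which `B ≤ 10⁸`, `p ≥ 5`, `n ≥ 2`
guarantee (`2.31 · 10⁸ > 2 · 10⁸ + 1` in the worst case `n = 2`, `p = 5`). The fact itself (all
`B`) is Yu's theorem and remains undischarged for `n ≥ 2`.
[cite: Stewart2013, Lemma 5 (case K = ℚ, B ≤ 10⁸)] -/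
theorem Stewart2013_lemma5_rat_of_stewartB_le (n p : ℕ) (α : Fin n → ℚ) (b : Fin n → ℤ)
    (hp : p.Prime) (hp5 : 5 ≤ p) (hα : ∀ i, α i ≠ 0 ∧ padicValRat p (α i) = 0)
    (hind : ∀ e : Fin n → ℤ, ∏ i, α i ^ e i = 1 → e = 0) (hb : b ≠ 0)
    (hB : stewartB b ≤ 10 ^ 8) :
    (padicValRat p (∏ i, α i ^ b i - 1) : ℝ) <
      stewartC n p (stewartDelta p α) * (∏ i, logHeight₁ (α i)) *
        max (Real.log (stewartB b)) ((n + 1) * (5.4 * n)) := by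
  rcases Nat.lt_or_ge n 2 with hn | hn
  · exact Stewart2013_lemma5_rat_of_le_one n p (by omega) α b hp hp5 hα hind hb
  -- `n ≥ 2`: the Liouville range
  have hp' : (5 : ℝ) ≤ p := by exact_mod_cast hp5
  set L := Real.log p with hLdef
  set l := Real.log 2 with hldef
  set P := ∏ i, logHeight₁ (α i) with hPdef
  set S := ∑ i, logHeight₁ (α i) with hSdef
  set B : ℝ := (stewartB b : ℝ) with hBdef
  set M := max (Real.log B) ((n + 1) * (5.4 * n)) with hMdef
  set C := stewartC n p (stewartDelta p α) with hCdef
  set v : ℝ := (padicValRat p (∏ i, α i ^ b i - 1) : ℝ) with hvdef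
  have hL : 1.6 < L := lt_of_lt_of_le log_five_gt_d1 (Real.log_le_log (by norm_num) hp')
  have hl0 : 0.6931471803 < l := Real.log_two_gt_d9
  have hnR : (2 : ℝ) ≤ n := by exact_mod_cast hn
  have hB8 : B ≤ 10 ^ 8 := by rw [hBdef]; exact_mod_cast hB
  have hB0 : 0 ≤ B := Nat.cast_nonneg _
  -- heights are at least `log 2`
  have hh : ∀ i, l ≤ logHeight₁ (α i) := fun i =>
    log_two_le_logHeight₁ (hα i).1 (ne_one_and_ne_neg_one_of_multIndep hind i).1
      (ne_one_and_ne_neg_one_of_multIndep hind i).2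
  have hPi : ∀ i, logHeight₁ (α i) * l ^ (n - 1) ≤ P := fun i =>
    mul_pow_pred_le_prod (fun j => logHeight₁ (α j)) (by linarith) hh i
  have hl0' : 0 < l := by linarith
  have hlpow : 0 ≤ l ^ (n - 1) := pow_nonneg hl0'.le _
  have hln : l * l ^ (n - 1) ≤ P := by
    have h : ∏ _j : Fin n, l ≤ P := Finset.prod_le_prod (fun _ _ => hl0'.le) fun j _ => hh j
    rw [Finset.prod_const, card_univ, Fintype.card_fin] at h
    calc l * l ^ (n - 1) = l ^ n := by
          rw [← pow_succ']
          congr 1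
          omega
      _ ≤ P := h
  have hS : S * l ^ (n - 1) ≤ n * P := by
    rw [hSdef, Finset.sum_mul]
    calc ∑ i, logHeight₁ (α i) * l ^ (n - 1) ≤ ∑ _i : Fin n, P :=
          Finset.sum_le_sum fun i _ => hPi i
      _ = n * P := by rw [Finset.sum_const, card_univ, Fintype.card_fin, nsmul_eq_mul]
  -- the Liouville estimate
  have hΞ : ∏ i, α i ^ b i ≠ 1 := fun h => hb (hind b h)
  have hLiou : v * L ≤ l + B * S := by
    have h1 := padicValRat_prod_zpow_sub_one_mul_log_le hp α b hΞ
    have h2 : ∑ i, ((b i).natAbs : ℝ) * logHeight₁ (α i) ≤ B * S := by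
      rw [hSdef, Finset.mul_sum]
      refine Finset.sum_le_sum fun i _ => ?_
      have hbi : ((b i).natAbs : ℝ) ≤ B := by
        rw [hBdef]; exact_mod_cast natAbs_le_stewartB b i
      exact mul_le_mul_of_nonneg_right hbi (zero_le_logHeight₁ _)
    rw [hvdef, hLdef, hldef]
    linarith
  have hvP : v * L * l ^ (n - 1) ≤ (1 + n * B) * P := by
    calc v * L * l ^ (n - 1) ≤ (l + B * S) * l ^ (n - 1) :=
          mul_le_mul_of_nonneg_right hLiou hlpow
      _ = l * l ^ (n - 1) + B * (S * l ^ (n - 1)) := by ring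
      _ ≤ P + B * (n * P) := add_le_add hln (mul_le_mul_of_nonneg_left hS hB0)
      _ = (1 + n * B) * P := by ring
  -- lower bounds for the right-hand side
  have hC : 1504 * ((7 * Real.exp 1) ^ n * Real.exp 1 ^ n) * L ≤ C := stewartC_ge n hp5 _
  have hgeom : (1853 : ℝ) ≤ (7 * Real.exp 1) ^ n * Real.exp 1 ^ n * l ^ (n - 1) :=
    stewart_geom_factor_ge hn
  have hM : ((n : ℝ) + 1) * (5.4 * n) ≤ M := le_max_right _ _
  have hM1 : (0 : ℝ) ≤ ((n : ℝ) + 1) * (5.4 * n) := by positivity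
  have hP0 : 0 < P := by
    rw [hPdef]
    exact Finset.prod_pos fun i _ => lt_of_lt_of_le hl0' (hh i)
  have hL0 : 0 < L := by linarith
  have hLl : 0 < L * l ^ (n - 1) := mul_pos hL0 (pow_pos hl0' _)
  -- `C · (L · l^{n-1}) ≥ 1504 · 1853 · 2.56`
  have h1 : (1504 : ℝ) * 1853 * 2.56 ≤ C * (L * l ^ (n - 1)) := by
    have hLL : (2.56 : ℝ) ≤ L * L := by nlinarith
    have hX0 : (0 : ℝ) ≤ (7 * Real.exp 1) ^ n * Real.exp 1 ^ n * l ^ (n - 1) := by positivity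
    calc (1504 : ℝ) * 1853 * 2.56
        ≤ 1504 * ((7 * Real.exp 1) ^ n * Real.exp 1 ^ n * l ^ (n - 1)) * (L * L) := by
          have := mul_le_mul hgeom hLL (by norm_num) hX0
          linarith
      _ = 1504 * ((7 * Real.exp 1) ^ n * Real.exp 1 ^ n) * L * (L * l ^ (n - 1)) := by ring
      _ ≤ C * (L * l ^ (n - 1)) := mul_le_mul_of_nonneg_right hC hLl.le
  -- the numerical comparison `1 + nB < 1504 · 1853 · 2.56 · (n+1)(5.4 n)` for `n ≥ 2`, `B ≤ 10⁸`
  have h2 : (1 + n * B) < 1504 * 1853 * 2.56 * (((n : ℝ) + 1) * (5.4 * n)) := by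
    have hn3 : 3 * (n : ℝ) ≤ ((n : ℝ) + 1) * n := by nlinarith
    have hnB : (n : ℝ) * B ≤ n * 10 ^ 8 := mul_le_mul_of_nonneg_left hB8 (by positivity)
    nlinarith
  have hkey : (1 + n * B) * P < C * P * M * (L * l ^ (n - 1)) := by
    have hCY : (0 : ℝ) ≤ C * (L * l ^ (n - 1)) := le_trans (by norm_num) h1
    calc (1 + n * B) * P < 1504 * 1853 * 2.56 * (((n : ℝ) + 1) * (5.4 * n)) * P :=
          mul_lt_mul_of_pos_right h2 hP0
      _ ≤ C * (L * l ^ (n - 1)) * M * P :=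
          mul_le_mul_of_nonneg_right (mul_le_mul h1 hM hM1 hCY) hP0.le
      _ = C * P * M * (L * l ^ (n - 1)) := by ring
  have hfin : v * (L * l ^ (n - 1)) < C * P * M * (L * l ^ (n - 1)) := by
    calc v * (L * l ^ (n - 1)) = v * L * l ^ (n - 1) := by ring
      _ ≤ (1 + n * B) * P := hvP
      _ < _ := hkey
  exact lt_of_mul_lt_mul_right hfin hLl.le


/-! ### [Yu1989, Lemma 1.4] over `ℚ` (the input of [Yu2013, Lemma 2.1], case `r = 1`) -/

/-- `ord_p` of a non-zero integer against `emultiplicity`. [folklore] -/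
theorem padicValInt_coe_eq_emultiplicity {p : ℕ} (hp : p.Prime) {z : ℤ} (hz : z ≠ 0) :
    (padicValInt p z : ℕ∞) = emultiplicity (p : ℤ) z := by
  rw [padicValInt.of_ne_one_ne_zero hp.ne_one hz]
  exact ((Int.finiteMultiplicity_iff.mpr ⟨by simpa using hp.ne_one, hz⟩).emultiplicity_eq_multiplicity).symm

/-- **The one-logarithm bound over `ℚ`, sharp form:** for an odd prime `p`, a rational `p`-adic unit
`α = x/y` and `b ≠ 0` with `α^b ≠ 1`,
`ord_p(α^b − 1) · log p ≤ log 2 + r · h(α) + log |b|`, `r = |⟨ᾱ⟩|` the order of `ᾱ` in `𝔽_pˣ`: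
if `p ∤ x^{|b|} − y^{|b|}` the left side vanishes; otherwise `r ∣ |b| = rs`, and by the
lifting-the-exponent lemma `ord_p(x^{rs} − y^{rs}) = ord_p(x^r − y^r) + ord_p(s)` with
`p^{ord_p(x^r − y^r)} ≤ |x^r − y^r| ≤ 2 max(|x|, y)^r` and `p^{ord_p(s)} ≤ s ≤ |b|`.
[cite: Yu2013, §2, p. 327 (restatement of [35, Lemma 1.4]); Yu1989, Lemma 1.4] -/
theorem padicValRat_zpow_sub_one_mul_log_le_sharp {p : ℕ} (hp : p.Prime) (hp2 : p ≠ 2) {α : ℚ}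
    (hα0 : α ≠ 0) (hαv : padicValRat p α = 0) {b : ℤ} (hb : b ≠ 0) (hαb : α ^ b ≠ 1) :
    (padicValRat p (α ^ b - 1) : ℝ) * Real.log p ≤
      Real.log 2 + orderOf (ratModP p α) * logHeight₁ α + Real.log |(b : ℝ)| := by
  haveI := Fact.mk hp
  -- notation
  set n := b.natAbs with hn
  have hn0 : n ≠ 0 := Int.natAbs_ne_zero.mpr hb
  set x : ℤ := α.num with hx
  set y : ℤ := (α.den : ℤ) with hy
  set r := orderOf (ratModP p α) with hr
  obtain ⟨hpx', hpy'⟩ := padicUnit_not_dvd_num_den hp hα0 hαv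
  have hpx : ¬ (p : ℤ) ∣ x := fun h => hpx' (Int.natCast_dvd.mp h)
  have hpy : ¬ (p : ℤ) ∣ y := fun h => hpy' (Int.natCast_dvd_natCast.mp h)
  have hy0 : y ≠ 0 := by rw [hy]; exact_mod_cast α.den_pos.ne'
  have hx0 : x ≠ 0 := Rat.num_ne_zero.mpr hα0
  have hlogp : 0 < Real.log p := Real.log_pos (by exact_mod_cast hp.one_lt)
  -- `α^b - 1` against `α^n - 1`, and `α^n ≠ 1`
  have hvn : padicValRat p (α ^ b - 1) = padicValRat p (α ^ n - 1) :=
    padicValRat_zpow_sub_one_eq_natAbs hα0 hαv b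
  have hαn : α ^ n ≠ 1 := by
    intro h1
    apply hαb
    rcases Int.natAbs_eq b with hb' | hb'
    · rw [hb', zpow_natCast]; exact h1
    · rw [hb', zpow_neg, zpow_natCast, h1, inv_one]
  -- `α^n - 1 = (x^n - y^n)/y^n`
  have hαxy : α = (x : ℚ) / (y : ℚ) := by
    rw [hx, hy, Int.cast_natCast, Rat.num_div_den]
  set D : ℤ := x ^ n - y ^ n with hD
  have hD0 : D ≠ 0 := by
    intro hD0
    apply hαn
    have hxy : (x : ℚ) ^ n = (y : ℚ) ^ n := by exact_mod_cast (sub_eq_zero.mp hD0)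
    rw [hαxy, div_pow, hxy, div_self (pow_ne_zero _ (by exact_mod_cast hy0))]
  have hvD : padicValRat p (α ^ n - 1) = padicValInt p D := by
    have hyn0 : ((y : ℚ)) ^ n ≠ 0 := pow_ne_zero _ (by exact_mod_cast hy0)
    have heq : α ^ n - 1 = ((D : ℤ) : ℚ) / (((y ^ n : ℤ)) : ℚ) := by
      rw [hαxy, hD]; push_cast
      rw [div_pow, div_sub_one hyn0]
    rw [heq, padicValRat.div (by exact_mod_cast hD0) (by exact_mod_cast pow_ne_zero n hy0),
      padicValRat.of_int, padicValRat.of_int,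
      padicValInt.eq_zero_of_not_dvd (fun h => hpy (Int.Prime.dvd_pow' hp h)), Nat.cast_zero,
      sub_zero]
  -- the right side is non-negative term by term
  have hh0 : 0 ≤ logHeight₁ α := zero_le_logHeight₁ _
  have hb1 : (1 : ℝ) ≤ |(b : ℝ)| := by
    rw [← Int.cast_abs]; exact_mod_cast Int.one_le_abs hb
  have hlogb : 0 ≤ Real.log |(b : ℝ)| := Real.log_nonneg hb1
  have hlog2 : 0 ≤ Real.log 2 := Real.log_nonneg (by norm_num)
  have hr0 : 0 < r := orderOf_ratModP_pos hp hα0 hαv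
  by_cases hpD : (p : ℤ) ∣ D
  swap
  · -- `p ∤ x^n - y^n`: the order vanishes
    rw [hvn, hvD, padicValInt.eq_zero_of_not_dvd hpD]
    simp only [Nat.cast_zero, Int.cast_zero, zero_mul]
    positivity
  -- `p ∣ x^n - y^n`: then `r ∣ n`
  have hden : (α.den : ZMod p) ≠ 0 := fun h => hpy' ((ZMod.natCast_eq_zero_iff _ _).mp h)
  have hcongr_n : (x : ZMod p) ^ n = (α.den : ZMod p) ^ n := by
    have : ((D : ℤ) : ZMod p) = 0 := (ZMod.intCast_zmod_eq_zero_iff_dvd D p).mpr hpD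
    rw [hD] at this; push_cast at this
    rw [hy] at this; push_cast at this
    exact sub_eq_zero.mp this
  have hun : (ratModP p α) ^ n = 1 := by
    unfold ratModP
    rw [mul_pow, ← hx, hcongr_n, ← mul_pow, mul_inv_cancel₀ hden, one_pow]
  obtain ⟨s, hs⟩ : r ∣ n := orderOf_dvd_of_pow_eq_one hun
  have hs0 : s ≠ 0 := by rintro rfl; exact hn0 (by rw [hs, mul_zero])
  -- `p ∣ x^r - y^r`
  have hcongr_r : (x : ZMod p) ^ r = (α.den : ZMod p) ^ r := by
    have h1 : (ratModP p α) ^ r = 1 := pow_orderOf_eq_one _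
    unfold ratModP at h1
    rw [mul_pow, ← hx, inv_pow] at h1
    have := congrArg (· * (α.den : ZMod p) ^ r) h1
    simpa [inv_mul_cancel_right₀ (pow_ne_zero r hden)] using this
  set D' : ℤ := x ^ r - y ^ r with hD'
  have hpD' : (p : ℤ) ∣ D' := by
    apply (ZMod.intCast_zmod_eq_zero_iff_dvd D' p).mp
    rw [hD', hy]; push_cast
    rw [hcongr_r, sub_self]
  have hD'0 : D' ≠ 0 := by
    intro h0
    apply hD0
    have hxr : x ^ r = y ^ r := sub_eq_zero.mp h0
    rw [hD, hs, pow_mul, pow_mul, hxr, sub_self]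
  -- lifting the exponent
  have hodd : Odd p := hp.odd_of_ne_two hp2
  have hLTE := Int.emultiplicity_pow_sub_pow hp hodd (x := x ^ r) (y := y ^ r) hpD'
    (fun h => hpx (Int.Prime.dvd_pow' hp h)) s
  rw [← pow_mul, ← pow_mul, ← hs] at hLTE
  have hval : padicValInt p D = padicValInt p D' + padicValNat p s := by
    have h1 := padicValInt_coe_eq_emultiplicity hp hD0
    have h2 := padicValInt_coe_eq_emultiplicity hp hD'0
    have h3 : (padicValNat p s : ℕ∞) = emultiplicity p s := padicValNat_eq_emultiplicity hs0
    rw [hD] at h1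
    rw [hD'] at h2
    have : (padicValInt p D : ℕ∞) = (padicValInt p D' : ℕ∞) + (padicValNat p s : ℕ∞) := by
      rw [hD, hD', h1, h2, h3]; exact hLTE
    exact_mod_cast this
  -- the two archimedean bounds
  have hM1 : (1 : ℝ) ≤ ((max x.natAbs α.den : ℕ) : ℝ) := by
    exact_mod_cast le_trans α.den_pos (le_max_right _ _)
  have hbound1 : (padicValInt p D' : ℝ) * Real.log p ≤ Real.log 2 + r * logHeight₁ α := by
    have hN0 : D'.natAbs ≠ 0 := Int.natAbs_ne_zero.mpr hD'0
    have h1 : (padicValNat p D'.natAbs : ℝ) * Real.log p ≤ Real.log (D'.natAbs : ℝ) :=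
      padicValNat_mul_log_le hp hN0
    have hle : D'.natAbs ≤ 2 * (max x.natAbs α.den) ^ r := by
      rw [hD']
      calc (x ^ r - y ^ r).natAbs ≤ (x ^ r).natAbs + (y ^ r).natAbs := Int.natAbs_sub_le _ _
        _ = x.natAbs ^ r + α.den ^ r := by rw [Int.natAbs_pow, Int.natAbs_pow, hy, Int.natAbs_natCast]
        _ ≤ (max x.natAbs α.den) ^ r + (max x.natAbs α.den) ^ r :=
            add_le_add (Nat.pow_le_pow_left (le_max_left _ _) _)
              (Nat.pow_le_pow_left (le_max_right _ _) _)
        _ = 2 * (max x.natAbs α.den) ^ r := by ring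
    have h2 : Real.log (D'.natAbs : ℝ) ≤ Real.log 2 + r * logHeight₁ α := by
      rw [Rat.logHeight₁_eq_log_max, ← hx, ← Real.log_pow, ← Real.log_mul (by norm_num) (by positivity)]
      apply Real.log_le_log (by exact_mod_cast Nat.pos_of_ne_zero hN0)
      exact_mod_cast hle
    have h3 : (padicValInt p D' : ℝ) = (padicValNat p D'.natAbs : ℝ) := by
      simp [padicValInt]
    rw [h3]; linarith
  have hbound2 : (padicValNat p s : ℝ) * Real.log p ≤ Real.log |(b : ℝ)| := by
    have h1 : (padicValNat p s : ℝ) * Real.log p ≤ Real.log (s : ℝ) := padicValNat_mul_log_le hp hs0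
    have hsn : (s : ℝ) ≤ |(b : ℝ)| := by
      have : s ≤ n := by rw [hs]; exact Nat.le_mul_of_pos_left s hr0
      have h' : (n : ℝ) = |(b : ℝ)| := by rw [hn, Nat.cast_natAbs, Int.cast_abs]
      rw [← h']; exact_mod_cast this
    have h2 : Real.log (s : ℝ) ≤ Real.log |(b : ℝ)| :=
      Real.log_le_log (by exact_mod_cast Nat.pos_of_ne_zero hs0) hsn
    linarith
  rw [hvn, hvD, hval, Int.cast_natCast, Nat.cast_add, add_mul]
  linarith [hbound1, hbound2]

/-- **[Yu1989, Lemma 1.4] for `K = ℚ` and odd `p`, as restated in [Yu2013, §2 (p. 327)]:**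
"Suppose that `α` is a `℘`-adic unit in a number field `K` of degree `d` and `b ∈ ℤ ∖ {0}`. If
`α^b ≠ 1`, then `ord_℘(α^b − 1) ≤ (d/(f_℘ log p)) (log(2|b|) + |⟨ᾱ⟩| (1 + 1/(p−1)) e_℘ h₀(α))`,
where `|⟨ᾱ⟩|` denotes the cardinality of `⟨ᾱ⟩` as a subgroup of `K̄ˣ`" — the input of
[Yu2013, Lemma 2.1] (Theorem I in the case `r = 1` of the basic hypothesis). Here `K = ℚ`:
`d = 1`, `℘ = p`, `e_℘ = f_℘ = 1`, `h₀ = logHeight₁`, `|⟨ᾱ⟩| = orderOf ᾱ`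
(`ᾱ = ratModP p α ∈ 𝔽_pˣ`); proved (in the sharper form
`padicValRat_zpow_sub_one_mul_log_le_sharp`, coefficient `1` in place of `1 + 1/(p−1)`) by the
lifting-the-exponent lemma. Only odd `p` is treated here (the paper allows every `℘`; the tree
uses `p ≥ 5`); the case `p = 2` is `yu1989_lemma1_4_rat_two` below, and `yu1989_lemma1_4_rat'`
covers every prime.
[cite: Yu1989, Lemma 1.4] [cite: Yu2013, §2, p. 327] -/
theorem yu1989_lemma1_4_rat {p : ℕ} (hp : p.Prime) (hp2 : p ≠ 2) {α : ℚ}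
    (hα0 : α ≠ 0) (hαv : padicValRat p α = 0) {b : ℤ} (hb : b ≠ 0) (hαb : α ^ b ≠ 1) :
    (padicValRat p (α ^ b - 1) : ℝ) ≤
      1 / Real.log p * (Real.log (2 * |(b : ℝ)|) +
        orderOf (ratModP p α) * (1 + 1 / ((p : ℝ) - 1)) * logHeight₁ α) := by
  have h := padicValRat_zpow_sub_one_mul_log_le_sharp hp hp2 hα0 hαv hb hαb
  have hlogp : 0 < Real.log p := Real.log_pos (by exact_mod_cast hp.one_lt)
  have hp1 : (1 : ℝ) < p := by exact_mod_cast hp.one_lt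
  have hb0 : (0 : ℝ) < |(b : ℝ)| := by
    rw [← Int.cast_abs]; exact_mod_cast Int.one_le_abs hb
  have hlog2b : Real.log (2 * |(b : ℝ)|) = Real.log 2 + Real.log |(b : ℝ)| :=
    Real.log_mul (by norm_num) hb0.ne'
  have hh0 : 0 ≤ logHeight₁ α := zero_le_logHeight₁ _
  have hr0 : (0 : ℝ) ≤ orderOf (ratModP p α) := Nat.cast_nonneg _
  have hextra : (orderOf (ratModP p α) : ℝ) * logHeight₁ α ≤
      orderOf (ratModP p α) * (1 + 1 / ((p : ℝ) - 1)) * logHeight₁ α := by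
    have : (1 : ℝ) ≤ 1 + 1 / ((p : ℝ) - 1) := by
      have : (0 : ℝ) ≤ 1 / ((p : ℝ) - 1) := div_nonneg zero_le_one (by linarith)
      linarith
    calc (orderOf (ratModP p α) : ℝ) * logHeight₁ α = orderOf (ratModP p α) * 1 * logHeight₁ α := by
          ring
      _ ≤ _ := mul_le_mul_of_nonneg_right (mul_le_mul_of_nonneg_left this hr0) hh0
  rw [hlog2b, div_mul_eq_mul_div, one_mul, le_div_iff₀ hlogp]
  linarith

/-! ### The one-logarithm bound at `p = 2` (Yu 1989, Lemma 1.4 for every prime) -/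

/-- **The one-logarithm bound over `ℚ` at `p = 2`, sharp form:** for a rational `2`-adic unit
`α = x/y` (`x, y` odd) and `b ≠ 0` with `α^b ≠ 1`,
`ord₂(α^b − 1) · log 2 ≤ log 2 + 2 h(α) + log |b|`.
If `x² = y²` then `α = −1`, `b` is odd and `α^b − 1 = −2`. Otherwise, by the lifting-the-exponent
lemma at `2` (`4 ∣ x² − y²`): `ord₂(x^{2|b|} − y^{2|b|}) = ord₂(x² − y²) + ord₂(|b|)`, while
`x^{|b|} − y^{|b|} ∣ x^{2|b|} − y^{2|b|}`, `2^{ord₂(x² − y²)} ≤ |x² − y²| ≤ 2 max(|x|, y)²` and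
`2^{ord₂ |b|} ≤ |b|`. This is the case `p = 2` (`|⟨ᾱ⟩| = 1`, coefficient `1 + 1/(p−1) = 2`) of
[Yu1989, Lemma 1.4], previously left open at `yu1989_lemma1_4_rat`. [cite: Yu1989, Lemma 1.4] -/
theorem padicValRat_zpow_sub_one_mul_log_le_two {α : ℚ} (hα0 : α ≠ 0)
    (hαv : padicValRat 2 α = 0) {b : ℤ} (hb : b ≠ 0) (hαb : α ^ b ≠ 1) :
    (padicValRat 2 (α ^ b - 1) : ℝ) * Real.log 2 ≤
      Real.log 2 + 2 * logHeight₁ α + Real.log |(b : ℝ)| := by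
  have hp : Nat.Prime 2 := Nat.prime_two
  haveI := Fact.mk hp
  -- notation
  set n := b.natAbs with hn
  have hn0 : n ≠ 0 := Int.natAbs_ne_zero.mpr hb
  set x : ℤ := α.num with hx
  set y : ℤ := (α.den : ℤ) with hy
  obtain ⟨hpx', hpy'⟩ := padicUnit_not_dvd_num_den hp hα0 hαv
  have hpx : ¬ (2 : ℤ) ∣ x := fun h => hpx' (Int.natCast_dvd.mp h)
  have hpy : ¬ (2 : ℤ) ∣ y := fun h => hpy' (Int.natCast_dvd_natCast.mp h)
  have hy0 : y ≠ 0 := by rw [hy]; exact_mod_cast α.den_pos.ne'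
  have hx0 : x ≠ 0 := Rat.num_ne_zero.mpr hα0
  have hlog2 : 0 < Real.log 2 := Real.log_pos (by norm_num)
  have hh0 : 0 ≤ logHeight₁ α := zero_le_logHeight₁ _
  have hb1 : (1 : ℝ) ≤ |(b : ℝ)| := by
    rw [← Int.cast_abs]; exact_mod_cast Int.one_le_abs hb
  have hlogb : 0 ≤ Real.log |(b : ℝ)| := Real.log_nonneg hb1
  -- `α^b - 1` against `α^n - 1`, and `α^n ≠ 1`
  have hvn : padicValRat 2 (α ^ b - 1) = padicValRat 2 (α ^ n - 1) :=
    padicValRat_zpow_sub_one_eq_natAbs hα0 hαv b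
  have hαn : α ^ n ≠ 1 := by
    intro h1
    apply hαb
    rcases Int.natAbs_eq b with hb' | hb'
    · rw [hb', zpow_natCast]; exact h1
    · rw [hb', zpow_neg, zpow_natCast, h1, inv_one]
  -- `α^n - 1 = (x^n - y^n)/y^n`
  have hαxy : α = (x : ℚ) / (y : ℚ) := by
    rw [hx, hy, Int.cast_natCast, Rat.num_div_den]
  set D : ℤ := x ^ n - y ^ n with hD
  have hD0 : D ≠ 0 := by
    intro hD0
    apply hαn
    have hxy : (x : ℚ) ^ n = (y : ℚ) ^ n := by exact_mod_cast (sub_eq_zero.mp hD0)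
    rw [hαxy, div_pow, hxy, div_self (pow_ne_zero _ (by exact_mod_cast hy0))]
  have hvD : padicValRat 2 (α ^ n - 1) = padicValInt 2 D := by
    have hyn0 : ((y : ℚ)) ^ n ≠ 0 := pow_ne_zero _ (by exact_mod_cast hy0)
    have heq : α ^ n - 1 = ((D : ℤ) : ℚ) / (((y ^ n : ℤ)) : ℚ) := by
      rw [hαxy, hD]; push_cast
      rw [div_pow, div_sub_one hyn0]
    rw [heq, padicValRat.div (by exact_mod_cast hD0) (by exact_mod_cast pow_ne_zero n hy0),
      padicValRat.of_int, padicValRat.of_int,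
      padicValInt.eq_zero_of_not_dvd (fun h => hpy (Int.Prime.dvd_pow' hp h)), Nat.cast_zero,
      sub_zero]
  -- the degenerate case `x² = y²`, i.e. `α = -1`
  by_cases hD' : x ^ 2 - y ^ 2 = 0
  · have hxy : x = y ∨ x = -y := sq_eq_sq_iff_eq_or_eq_neg.mp (sub_eq_zero.mp hD')
    have hy0' : (y : ℚ) ≠ 0 := by exact_mod_cast hy0
    have hα1 : α = 1 ∨ α = -1 := by
      rcases hxy with h | h
      · left; rw [hαxy, h, div_self hy0']
      · right; rw [hαxy, h]; push_cast; rw [neg_div, div_self hy0']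
    rcases hα1 with h1 | h1
    · exact absurd (by rw [h1, one_zpow]) hαb
    rcases Int.even_or_odd b with heven | hodd
    · exact absurd (by rw [h1, heven.neg_one_zpow]) hαb
    have hval : padicValRat 2 (α ^ b - 1) = 1 := by
      rw [h1, hodd.neg_one_zpow, show (-1 - 1 : ℚ) = -2 by norm_num, padicValRat.neg]
      exact_mod_cast padicValRat.self (p := 2) one_lt_two
    rw [hval, h1, logHeight₁_neg, logHeight₁_one]
    push_cast
    linarith
  -- generic case: LTE at `2` for `x², y²`
  have hxodd : Odd x := by rwa [← Int.not_even_iff_odd, even_iff_two_dvd]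
  have hyodd : Odd y := by rwa [← Int.not_even_iff_odd, even_iff_two_dvd]
  have h4 : (4 : ℤ) ∣ x ^ 2 - y ^ 2 := by
    rw [Int.dvd_iff_emod_eq_zero, Int.sub_emod, Int.sq_mod_four_eq_one_of_odd hxodd,
      Int.sq_mod_four_eq_one_of_odd hyodd]
    decide
  have hx2 : ¬ (2 : ℤ) ∣ x ^ 2 := by
    have h := hxodd.pow (n := 2)
    rw [← Int.not_even_iff_odd, even_iff_two_dvd] at h
    exact h
  have hLTE := Int.two_pow_sub_pow' n h4 hx2
  have hdvd : D ∣ (x ^ 2) ^ n - (y ^ 2) ^ n := ⟨x ^ n + y ^ n, by rw [hD]; ring⟩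
  have hle : emultiplicity 2 D ≤ emultiplicity 2 (x ^ 2 - y ^ 2) + emultiplicity (2 : ℤ) (n : ℤ) :=
    (emultiplicity_le_emultiplicity_of_dvd_right hdvd).trans_eq hLTE
  have hval : padicValInt 2 D ≤ padicValInt 2 (x ^ 2 - y ^ 2) + padicValNat 2 n := by
    have h1 := padicValInt_coe_eq_emultiplicity hp hD0
    have h2 := padicValInt_coe_eq_emultiplicity hp hD'
    have h3 : (padicValNat 2 n : ℕ∞) = emultiplicity 2 n := padicValNat_eq_emultiplicity hn0
    have h4' := Int.natCast_emultiplicity 2 n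
    simp only [Nat.cast_ofNat] at h1 h2 h4'
    rw [← h1, ← h2, h4', ← h3] at hle
    exact_mod_cast hle
  -- the two archimedean bounds
  have hbound1 : (padicValInt 2 (x ^ 2 - y ^ 2) : ℝ) * Real.log 2 ≤
      Real.log 2 + 2 * logHeight₁ α := by
    have hN0 : (x ^ 2 - y ^ 2).natAbs ≠ 0 := Int.natAbs_ne_zero.mpr hD'
    have h1 : (padicValNat 2 (x ^ 2 - y ^ 2).natAbs : ℝ) * Real.log 2 ≤
        Real.log ((x ^ 2 - y ^ 2).natAbs : ℝ) := by
      have := padicValNat_mul_log_le hp hN0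
      simpa only [Nat.cast_ofNat] using this
    have hle : (x ^ 2 - y ^ 2).natAbs ≤ 2 * (max x.natAbs α.den) ^ 2 := by
      calc (x ^ 2 - y ^ 2).natAbs ≤ (x ^ 2).natAbs + (y ^ 2).natAbs := Int.natAbs_sub_le _ _
        _ = x.natAbs ^ 2 + α.den ^ 2 := by
            rw [Int.natAbs_pow, Int.natAbs_pow, hy, Int.natAbs_natCast]
        _ ≤ (max x.natAbs α.den) ^ 2 + (max x.natAbs α.den) ^ 2 :=
            add_le_add (Nat.pow_le_pow_left (le_max_left _ _) _)
              (Nat.pow_le_pow_left (le_max_right _ _) _)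
        _ = 2 * (max x.natAbs α.den) ^ 2 := by ring
    have h2 : Real.log ((x ^ 2 - y ^ 2).natAbs : ℝ) ≤ Real.log 2 + 2 * logHeight₁ α := by
      rw [Rat.logHeight₁_eq_log_max, ← hx]
      have hM0 : (0 : ℝ) < ((max x.natAbs α.den : ℕ) : ℝ) := by
        exact_mod_cast lt_of_lt_of_le α.den_pos (le_max_right _ _)
      have : Real.log 2 + 2 * Real.log ((max x.natAbs α.den : ℕ) : ℝ) =
          Real.log ((2 * (max x.natAbs α.den) ^ 2 : ℕ) : ℝ) := by
        push_cast
        rw [Real.log_mul (by norm_num) (by positivity), Real.log_pow]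
        push_cast; ring
      rw [this]
      apply Real.log_le_log (by exact_mod_cast Nat.pos_of_ne_zero hN0)
      exact_mod_cast hle
    have h3 : (padicValInt 2 (x ^ 2 - y ^ 2) : ℝ) = (padicValNat 2 (x ^ 2 - y ^ 2).natAbs : ℝ) := by
      simp [padicValInt]
    rw [h3]; linarith
  have hbound2 : (padicValNat 2 n : ℝ) * Real.log 2 ≤ Real.log |(b : ℝ)| := by
    have h1 : (padicValNat 2 n : ℝ) * Real.log 2 ≤ Real.log (n : ℝ) := by
      have := padicValNat_mul_log_le hp hn0
      simpa only [Nat.cast_ofNat] using this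
    have h' : (n : ℝ) = |(b : ℝ)| := by rw [hn, Nat.cast_natAbs, Int.cast_abs]
    rw [← h']; exact h1
  have hcast : (padicValRat 2 (α ^ b - 1) : ℝ) = (padicValInt 2 D : ℝ) := by
    rw [hvn, hvD, Int.cast_natCast]
  have hval' : (padicValInt 2 D : ℝ) ≤
      (padicValInt 2 (x ^ 2 - y ^ 2) : ℝ) + (padicValNat 2 n : ℝ) := by
    exact_mod_cast hval
  rw [hcast]
  nlinarith [hval', hbound1, hbound2, hlog2]

/-- **[Yu1989, Lemma 1.4] for `K = ℚ` at `p = 2`** (the case left open at `yu1989_lemma1_4_rat`):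
for a rational `2`-adic unit `α` and `b ≠ 0` with `α^b ≠ 1`,
`ord₂(α^b − 1) ≤ (1/log 2) (log(2|b|) + |⟨ᾱ⟩| (1 + 1/(p−1)) h(α))` with `p = 2`, where
`|⟨ᾱ⟩| = orderOf ᾱ` (`= 1` in `𝔽₂ˣ`) and `1 + 1/(p − 1) = 2`; from
`padicValRat_zpow_sub_one_mul_log_le_two`. [cite: Yu1989, Lemma 1.4] -/
theorem yu1989_lemma1_4_rat_two {α : ℚ} (hα0 : α ≠ 0) (hαv : padicValRat 2 α = 0) {b : ℤ}
    (hb : b ≠ 0) (hαb : α ^ b ≠ 1) :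
    (padicValRat 2 (α ^ b - 1) : ℝ) ≤
      1 / Real.log 2 * (Real.log (2 * |(b : ℝ)|) +
        orderOf (ratModP 2 α) * (1 + 1 / ((2 : ℝ) - 1)) * logHeight₁ α) := by
  have h := padicValRat_zpow_sub_one_mul_log_le_two hα0 hαv hb hαb
  have hlog2 : 0 < Real.log 2 := Real.log_pos (by norm_num)
  have hb0 : (0 : ℝ) < |(b : ℝ)| := by
    rw [← Int.cast_abs]; exact_mod_cast Int.one_le_abs hb
  have hlog2b : Real.log (2 * |(b : ℝ)|) = Real.log 2 + Real.log |(b : ℝ)| :=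
    Real.log_mul (by norm_num) hb0.ne'
  have hh0 : 0 ≤ logHeight₁ α := zero_le_logHeight₁ _
  have hr1 : (1 : ℝ) ≤ orderOf (ratModP 2 α) := by
    exact_mod_cast orderOf_ratModP_pos Nat.prime_two hα0 hαv
  have hextra : 2 * logHeight₁ α ≤ orderOf (ratModP 2 α) * (1 + 1 / ((2 : ℝ) - 1)) * logHeight₁ α := by
    have : (1 + 1 / ((2 : ℝ) - 1)) = 2 := by norm_num
    rw [this]
    nlinarith
  rw [hlog2b, div_mul_eq_mul_div, one_mul, le_div_iff₀ hlog2]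
  linarith

/-- **[Yu1989, Lemma 1.4] for `K = ℚ`, every prime `p`:** for a rational `p`-adic unit `α` and
`b ≠ 0` with `α^b ≠ 1`,
`ord_p(α^b − 1) ≤ (1/log p) (log(2|b|) + |⟨ᾱ⟩| (1 + 1/(p−1)) h(α))`, `|⟨ᾱ⟩| = orderOf ᾱ` in
`𝔽_pˣ` — `yu1989_lemma1_4_rat` (odd `p`) and `yu1989_lemma1_4_rat_two` (`p = 2`) combined; this is
the printed lemma for `d = 1` without restriction on `p` (the one-logarithm case `n = 1` from which
Yu's theorems are deduced, [Yu1999, §14–15]). [cite: Yu1989, Lemma 1.4] -/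
theorem yu1989_lemma1_4_rat' {p : ℕ} (hp : p.Prime) {α : ℚ} (hα0 : α ≠ 0)
    (hαv : padicValRat p α = 0) {b : ℤ} (hb : b ≠ 0) (hαb : α ^ b ≠ 1) :
    (padicValRat p (α ^ b - 1) : ℝ) ≤
      1 / Real.log p * (Real.log (2 * |(b : ℝ)|) +
        orderOf (ratModP p α) * (1 + 1 / ((p : ℝ) - 1)) * logHeight₁ α) := by
  rcases eq_or_ne p 2 with rfl | hp2
  · have h := yu1989_lemma1_4_rat_two hα0 hαv hb hαb
    simpa only [Nat.cast_ofNat] using h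
  · exact yu1989_lemma1_4_rat hp hp2 hα0 hαv hb hαb

end Literature.NumberTheory.DiophantineGeometry.Dioph
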